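import Summits.AtomisticToContinuum.HydrodynamicLimit.Theorems.BoxDissipativeWeakStrongDefs
import Summits.AtomisticToContinuum.HydrodynamicLimit.Theorems.BoxDissipativeWeakStrongEntropyAdmissibilityStubEntropyModulus
import Summits.AtomisticToContinuum.HydrodynamicLimit.Theorems.BoxDissipativeWeakStrongEntropyAdmissibilityStubInitialEntropyLLN
import Summits.AtomisticToContinuum.HydrodynamicLimit.Theorems.BoxDissipativeWeakStrongEntropyAdmissibilityStubDynPartIntegrable
import Summits.AtomisticToContinuum.HydrodynamicLimit.Theorems.BoxDissipativeWeakStrongEntropyAdmissibilityStubConcentrationOfPTBC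
import Summits.AtomisticToContinuum.HydrodynamicLimit.Theorems.BoxDissipativeWeakStrongEntropyAdmissibilityMeanEntropyDeficitNecessary
import Summits.AtomisticToContinuum.HydrodynamicLimit.Theorems.BoxDissipativeWeakStrongEntropyAdmissibilityDynamicCore
import Summits.AtomisticToContinuum.HydrodynamicLimit.Theorems.BoxDissipativeWeakStrongEntropyAdmissibilityStubConcentrationOfPTBCInBand
import Summits.AtomisticToContinuum.HydrodynamicLimit.Theorems.BoxDissipativeWeakStrongEntropyAdmissibilityStubPositiveTimeBoxConcentrationPrelim
import Summits.AtomisticToContinuum.HydrodynamicLimit.Theorems.BoxDissipativeWeakStrongEntropyAdmissibilityOfOpenStubs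
import Summits.AtomisticToContinuum.HydrodynamicLimit.Theorems.BoxDissipativeWeakStrongEntropyAdmissibilityGlobalClampedHTheorem
import Summits.AtomisticToContinuum.HydrodynamicLimit.Theorems.BoxDissipativeWeakStrongEntropyAdmissibilityStubGlobalEquilibriumEntropyBalance
import Summits.AtomisticToContinuum.HydrodynamicLimit.Theorems.BoxDissipativeWeakStrongEntropyAdmissibilityGlobalEquilibrium
import Summits.AtomisticToContinuum.HydrodynamicLimit.Theorems.BoxDissipativeWeakStrongEntropyAdmissibilityMacroConcentrationOfPTBCInBand
import Summits.AtomisticToContinuum.HydrodynamicLimit.Theorems.BoxDissipativeWeakStrongEntropyAdmissibilityStubFsEntropyFunctionalsLLN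
import Summits.AtomisticToContinuum.HydrodynamicLimit.Theorems.BoxDissipativeWeakStrongEntropyAdmissibilityStubSmoothRenormalizedEntropyConservation
import Summits.AtomisticToContinuum.HydrodynamicLimit.Theorems.BoxDissipativeWeakStrongEntropyAdmissibilityStubClampedRenormalizedEntropyConservation
import Summits.AtomisticToContinuum.HydrodynamicLimit.Theorems.BoxDissipativeWeakStrongEntropyAdmissibilityStubCruxOfFineScaleLLN
import Summits.AtomisticToContinuum.HydrodynamicLimit.Theses.BoxDissipativeWeakStrong

/-!
# Skeleton of the crux `EntropyAdmissibility` (stmt-AtomisticToContinuum-9903), line `registered`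
# (= BC3 birth skeleton `Lines/birth.lean`), lead reshapes r1/r2 (2026-08-17), continuation lead c1 (r3, 2026-08-17)

Route `route-AtomisticToContinuum-BoxDissipativeWeakStrong`, sub-problem `HydrodynamicLimit`, crux decl
`Summit.AtomisticToContinuum.HydrodynamicLimit.Theses.BoxDissipativeWeakStrong.EntropyAdmissibility`
(card K2: the clamp-renormalised LOCAL entropy inequality of Březina–Feireisl, Def. 2.9, for the law of the
hard-sphere BOX state, in expectation, zero defect: for `τ < T`, `a < b`, smooth `φ ≥ 0`,
`E_{P_N}[(Q_N)⁺] → 0` where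
`Q_N = ∫_0^τ∫(ρ̂ Z_{a,b}(ŝ) ∂_tφ + Z_{a,b}(ŝ) m̂·∇φ) − ∫ρ̂ Z_{a,b}(ŝ) φ|_τ + ∫ρ̂ Z_{a,b}(ŝ) φ|_0`).
Birth skeleton by `planner-skel-stmt-AtomisticToContinuum-9903-0`; reshape r1 by the lead
`prover-line-stmt-AtomisticToContinuum-9903-0`. Nothing below restates the crux or the Statement.

## The cut (unchanged) — "statics at time zero + annealed local second law + no anomalous entropy fluctuations"

`Q_N = A_N + B_N` with the DYNAMIC part `A_N = dynPart` (bulk transport terms minus the time-`τ` boundary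
term) and the INITIAL part `B_N = initPart`; `B = initLimit` is the clamped cut entropy of the Euler data
tested with `φ(0,·)`. S0: `B_N → B` in `L¹(P_N)`; S1: `A_N ∈ L¹(P_N)` and `limsup (E[A_N] + B) ≤ 0`;
S2: `A_N − E[A_N] → 0` in `L¹(P_N)`; composition `EntropyAdmissibility_of : S0 → S1 → S2 → crux`
(pointwise `(A + B_N)⁺ ≤ |A − E A| + (E A + B)⁺ + |B_N − B|`, squeeze `tendsto_lintegral_ofReal_add_of_parts`).

## Reshape r1 (lead, 2026-08-17) — 5 registered stubs, composition unchanged in substance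

* The §0 OBJECTS now live in the tree module `Theorems/BoxDissipativeWeakStrongDefs.lean` (landed p146875, namespace
  `Summit.AtomisticToContinuum.HydrodynamicLimit.Theorems.BDWS`, registered bookkeeping stub `stub_objects`) and the clamp is
  the tree's `Literature.Analysis.FluidPDE.CompressibleEuler.clamp`.
* S0 is split into two INDEPENDENT stubs: `stub_entropyModulus` (S0a, deterministic real analysis: a uniform
  modulus of continuity of the clamped cut entropy `(r,m,e) ↦ Z_{a,b}(s_cut(r, θ̂(r,m,e)))` relative to a compact
  set of physical states in the band — continuity of `f_ex` on `[0,η₀)` is a HYPOTHESIS of S0a, supplied from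
  `HsEosLowDensity` by S0b) and `stub_initialEntropyLLN_of_modulus` (S0b: S0a → S0, the measure-theoretic assembly
  over the landed `LGFS.localGibbsFineScale_of_pos`: pointwise `|Z(ŝ) − Z(s)| ≤ ε + (2M/δ)·dev`, `dev =
  |ρ̂−ρ₀| + ‖m̂−m₀‖ + |Ê−E₀|`, integrate). `initialEntropyLLN : Sig.stub_initialEntropyLLN` is now DERIVED.
* S1 is split into `stub_dynPartIntegrable` (S1a, provable: `A_N ∈ L¹(P_N)` for every `N` — joint measurability
  of the flow on its good set `HardSphereFlow.measurable_flow_prod_torus`, `|A_N| ≲ 1 + (N+1)⁻¹ Σ‖vᵢ‖²` by energy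
  conservation, Maxwellian second moments) and `stub_meanEntropyDeficit` (S1b, THE HEART, open: `∀ ε > 0`,
  eventually `E[A_N] + B ≤ ε`). `meanEntropyInequality : Sig.stub_meanEntropyInequality` is DERIVED
  (`meanEntropyInequality_of`, common thresholds by `min`).
* S2 `stub_entropyBalanceConcentration` unchanged in r1; reshape r2 (after wave 1: S0a p148838, S0b p149919, S1a p150196 LANDED;
  worker S2 `stub-blocked` with a typed missing fact): S2 is split into `stub_positiveTimeBoxConcentration` (S2a, OPEN: positive-time
  box-scale self-averaging of bounded/linear-growth local functionals, no limit identified) and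
  `stub_entropyBalanceConcentration_of_PTBC` (S2b = S2a → S2, provable). `entropyBalanceConcentration` is DERIVED.

Disproof used: none exists for this crux (`ledger crux ls`: PICKED.md, Lines/birth.{lean,md} only, 2026-08-17).

## r3–r6 (continuation lead `prover-line-stmt-AtomisticToContinuum-9903-c1-0`, 2026-08-17) — r4 sandwich stub (LANDED p156387, r5 import); r6 weakens S2a to its in-band form S2a' (worker S2a audit) with S2b' and adds the composition stub

Re-owned and re-checked (rc 0, sorries 2 = S1b, S2a). Status of the two open stubs, recorded for the disprover /
consult / planner: S1b `stub_meanEntropyDeficit` is NECESSARY for the crux (landed p153795, §3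
`meanEntropyDeficit_necessary`), hence crux-sized by theorem — no line can route around it; even its
space-homogeneous sub-case `φ = φ(t)` encodes monotonicity of the coarse-grained clamped entropy between two
positive times, which the Gibbs variational principle (comparison with `t = 0` only, mean fields only) does not
give. S2a `stub_positiveTimeBoxConcentration` is true at `t = 0` and along constant profiles, open otherwise.
r4: `Sig.stub_dynamicCore` (DynCore: `E[(A_N + B)⁺] → 0`, the crux minus statics) and the registered bookkeeping stub
`stub_dynamicCoreSandwich` = `(crux ↔ DynCore) ∧ (DynCore → S1b) ∧ (S1b → S2 → DynCore)` (tightness of the cut; §3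
derives `entropyAdmissibility_iff_dynamicCore` and `dynamicCore_of_open_stubs` from it).
r6: on worker S2a's audit (wave 2; `stub-blocked: PositiveTimeBoxConcentration`, audit clean, evidence `S2a-audit.md`;
prelim reductions LANDED p156703 `EABirthS2aPre.*`: constant profiles and `t = 0` reduce to statics) the open fluctuation
stub is WEAKENED to `stub_positiveTimeBoxConcentrationInBand` (S2a': same conclusion, asked only in the crux's frame — EOS
fact, band, packing guard), with S2b' `stub_entropyBalanceConcentration_of_PTBCInBand` (S2a' → S2, the landed S2b proof
with the guard passed through) and the composition stub `stub_cruxOfOpenStubs` (S1b → S2a' → crux, in the tree).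
OPEN after r6: S1b (heart, crux-equivalent) and S2a'. (S2b' LANDED p157094, imported r8; worker prelim `EABirthS2aPre` p156703 imported for the record.)
r7: the NECESSARY sub-target GCH (`Sig.globalClampedHTheorem`, global clamped H-theorem in mean: the crux at
space-homogeneous test functions) with the bookkeeping stub `stub_globalClampedHTheoremNecessary` = `(crux → GCH) ∧
(S1b → GCH)`; §3 derives `globalClampedHTheorem` (open through S1b) for the disprover's target list.
r8: everything provable has LANDED (S2b' p157094, composition p157831, GCH-necessity p158167; worker prelim p156703);
`sorry` remains exactly in the two open stubs S1b `stub_meanEntropyDeficit` and S2a' `stub_positiveTimeBoxConcentrationInBand`.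
STATUS: line CLOSED MODULO {S1b, S2a'}; S1b is crux-EQUIVALENT (p153795, p156387) ⇒ handed back `promote-stub` (PROMOTE.md).
r9 (continuation lead c2 `prover-line-stmt-AtomisticToContinuum-9903-c2-0`, 2026-08-17): the GLOBAL-EQUILIBRIUM sub-frame
(constant profiles `a₀, θ₀, u₀` and constant Euler state `ρ, u, θ`; `InFrameConst`) is the one place where the positive-time
dynamics is controllable with tree tools (the local Gibbs law is flow-invariant, `map_flow_localGibbsLaw_const`, so the
time-`t` law of every static box functional IS its time-`0` law). Three registered PROVABLE stubs carry it to a theorem: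
GE1 `stub_staticEntropyFunctionalsLLN` (static LLN at `t = 0` for the two entropy functionals `ρ̂ Z(ŝ) ψ` and `Z(ŝ) m̂·Ψ`,
GENERAL profiles, arbitrary continuous test data — S0 generalised; `InFrame Cge1`), GE2 `stub_testTransportIdentity`
(`∫_{(0,τ]}∫(h ∂ₜφ + h v·∇φ) − ∫ h φ_τ + ∫ h φ_0 = 0` on `𝕋³`, deterministic calculus), GE3
`stub_globalEquilibriumEntropyBalance` (GE1 → GE2 → `InFrameConst CdynAbs`: `A_N → −B` in `L¹(P_N)` at global equilibrium —
the entropy balance with EQUALITY, zero production). §3 derives from them S1b, S2, DynCore and the crux's own conclusion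
`Ccrux` on the global-equilibrium sub-frame (`InFrameConst Cdef / Cconc / Cdyn / Ccrux`), and `InFrame C → InFrameConst C`
records that this IS the crux specialised. OPEN (unchanged): S1b (heart, crux-equivalent), S2a'.
r10: wave 1 returned — GE1 p161002, GE2 p160969, GE3 p162417 (+ helpers p161932) LANDED; S2a' adversarial audit: stub-blocked (no artefact
refutation; t = 0 slice provable only for continuous G). Objects `InFrameConst`, `Cge1`, `CdynAbs` are now the tree's (EABirthGE3 / EABirthGE1);
bookkeeping stub `stub_globalEquilibriumConclusions` registered for the §3 sub-frame theorems. `sorry` exactly in S1b and S2a' again.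
r11: necessity-type stub `stub_macroConcentration_of_PTBCInBand` (S2a' ⇒ `InFrame Cmacro`, positive-time concentration of the
macroscopic empirical fields — S2a' is at least conjunct-fluctuation-strength), wave 2.
r12: wave 2 returned — `stub_macroConcentration_of_PTBCInBand` LANDED p164016 (EABirthMacro); GE conclusions LANDED p162825 (EABirthGE).
`sorry` exactly in S1b `stub_meanEntropyDeficit` and S2a' `stub_positiveTimeBoxConcentrationInBand`; 17 support files landed in total (6 this seat).
r13: the FINE-SCALE bridge — stubs FS1 `stub_fsEntropyFunctionalsLLN` (GE1 at time t under the time-t LLN), FS2a/FS2b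
`stub_smooth/clampedRenormalizedEntropyConservation` (weak renormalised entropy conservation of classical hs-Euler solutions; PDE), FS3
`stub_cruxOfFineScaleLLN` (assembly) ⇒ §3 `crux_of_fineScaleLLN : InFrame Cptlgfs → crux` (the crux follows from the box-scale
hydrodynamic limit in L¹ — consistency of K2 with smooth Euler dynamics, zero defect); wave 3.
r14: wave 3 returned — FS1 p164907, FS2a p165136, FS2b p165372, FS3 p165570 LANDED; `Cptlgfs`, `Cge1t` are now the tree's (EABirthFS3);
bookkeeping stub `stub_fineScaleBridge`. `sorry` exactly in S1b and S2a'; 21 support files landed in total (10 this seat).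
-/

noncomputable section

open MeasureTheory Filter Set
open scoped ENNReal Topology ContDiff

/-! ## §0 Objects: `Summits/AtomisticToContinuum/HydrodynamicLimit/Theorems/BoxDissipativeWeakStrongDefs.lean` (landed p146875;
namespace `Summit.AtomisticToContinuum.HydrodynamicLimit.Theorems.BDWS`, imported above). -/

namespace Summit.AtomisticToContinuum.HydrodynamicLimit.Cruxes.EntropyAdmissibility.Birth

open Literature.MathematicalPhysics.KineticTheory
open Literature.Analysis.FluidPDE.CompressibleEuler (clamp)
open Summit.AtomisticToContinuum.HydrodynamicLimit.Theses
open Summit.AtomisticToContinuum.HydrodynamicLimit.Theorems.BDWS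
open Summit.AtomisticToContinuum.HydrodynamicLimit.Theorems.EABirthCore (Conclusion InFrame Ccrux Cdyn Cstat Cint Cdef Cconc
  inFrame_stat inFrame_int entropyAdmissibility_iff_inFrame tendsto_lintegral_ofReal_of_le_add
  aemeasurable_ofReal_abs_initPart_sub)
open Summit.AtomisticToContinuum.HydrodynamicLimit.Theorems.EABirthS2bA (lintegral_ofReal_abs_sub_integral_le)
open Summit.AtomisticToContinuum.HydrodynamicLimit.Theorems.EABirthGE1 (Cge1)
open Summit.AtomisticToContinuum.HydrodynamicLimit.Theorems.EABirthGE3 (InFrameConst CdynAbs)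
open Summit.AtomisticToContinuum.HydrodynamicLimit.Theorems.EABirthFS3 (Cptlgfs Cge1t)

/-! ## §1 Stub signatures

Each stub's statement is the `Prop` `Sig.stub_<name>`, stated in the crux's OWN quantifier frame (EOS fact →
`∃ η_c > 0 ∀ η₁ < η_c ∀ profiles ∃ σ₀ ∀ σ < σ₀ ∀ classical solutions with ρσ³ ≤ η₁/2 ∀ flow families with the
t = 0 LLN ∀ kinetic windows ∀ τ ∈ [0,T) ∀ a < b ∀ smooth φ ≥ 0`, binders verbatim; the EOS hypothesis is the
route's `HsEosLowDensity`, proved in tree as `HsEosLowDensity_holds`); the registered obligations are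
`theorem stub_<name> : Sig.stub_<name> := by sorry` (§2: S0a, S0b, S1a, S1b, S2 after reshape r1); the former
stubs S0 `Sig.stub_initialEntropyLLN` and S1 `Sig.stub_meanEntropyInequality` keep their `Sig` and are DERIVED
(§3); the composition `EntropyAdmissibility_of` takes S0, S1, S2 as hypotheses BY NAME. -/

/-- **S0 — initial entropy LLN (statics; size M; DERIVED from S0a + S0b since reshape r1).** In the crux's frame, the initial part of the
entropy balance converges in `L¹(P_N)` to its deterministic value on the Euler data:
`E_{P_N} |B_N − B| → 0`. Why plausibly true: at `t = 0` the flow is the identity a.e.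
(`localGibbsLaw_preimage_flow_zero`), the landed `LocalGibbsFineScale` gives `L¹(P ⊗ dx)` convergence of the box
fields to `(ρ, ρu, E)(0,·)` in exactly this frame (`0 < T` from `τ ∈ [0,T)`), `θ̂ → θ(0,·) > 0` and `ρ̂ → ρ(0,·) > 0`
in measure make `ŝ → s_cut(ρ₀, θ₀)` in measure (continuity of `log` off `0` and of `F_cut` on `[0, η₁]`, `η₁`
below the EOS analyticity radius — take `η_c ≤ η₀(EOS)`), the clamp is `1`-Lipschitz and bounded, and
`|ρ̂ Z(ŝ) φ₀| ≤ (|a| ∨ |b|) ‖φ₀‖_∞ ρ̂` is uniformly integrable. Why it might fail: only through junk conventions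
at `ρ̂ = 0` / `θ̂ = 0` boxes, which carry vanishing mass (`(N+1)ℓ³ → ∞`). Leans on:
`Theorems.LGFS.localGibbsFineScale_of_pos`, `HsEosLowDensity_holds`, `isProbabilityMeasure_localGibbsLaw`. -/
def Sig.stub_initialEntropyLLN : Prop :=
  BoxDissipativeWeakStrong.HsEosLowDensity →
    ∃ ηc : ℝ, 0 < ηc ∧ ∀ η₁ : ℝ, 0 < η₁ → η₁ < ηc →
      ∀ (a₀ θ₀ : T3 → ℝ) (u₀ : T3 → V3), Continuous a₀ → Continuous θ₀ → Continuous u₀ →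
        (∀ x, 0 < a₀ x) → (∀ x, 0 < θ₀ x) →
        ∃ σ₀ : ℝ, 0 < σ₀ ∧ ∀ σ : ℝ, 0 < σ → σ < σ₀ →
          ∀ (T : ℝ) (ρ θ : ℝ → T3 → ℝ) (u : ℝ → T3 → V3), IsHardSphereEulerSolution σ T ρ u θ →
            (∀ t ∈ Ico 0 T, ∀ x, ρ t x * σ ^ 3 ≤ η₁ / 2) →
            ∀ Φ : FlowFamily σ,
              TendstoHydroFieldsAt (fun N => localGibbsLaw σ a₀ u₀ θ₀ N (Φ N)) Φ ρ u θ 0 →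
              ∀ ℓ : ℕ → ℝ, (∀ N, 0 < ℓ N ∧ ℓ N ≤ 1) → Tendsto ℓ atTop (𝓝 0) →
                Tendsto (fun N : ℕ => ℓ N ^ 3 * ((N : ℝ) + 1)) atTop atTop →
                ∀ τ ∈ Ico 0 T, ∀ a b : ℝ, a < b → ∀ φ : ℝ → T3 → ℝ,
                  Literature.Analysis.FunctionSpaces.Torus.IsSmoothSpaceTimeOn (Ico 0 T) φ →
                  (∀ t ∈ Icc 0 τ, ∀ x, 0 ≤ φ t x) →
                  Tendsto (fun N : ℕ => ∫⁻ z, ENNReal.ofReal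
                      |initPart σ η₁ ℓ Φ a b φ N z - initLimit σ η₁ ρ θ a b φ|
                    ∂(localGibbsLaw σ a₀ u₀ θ₀ N (Φ N))) atTop (𝓝 0)

/-- **S1 — annealed local entropy inequality (dynamics; DERIVED from S1a + S1b since reshape r1).** In the crux's frame:
for every `ε > 0`, eventually in `N`, the dynamic part `A_N` is `P_N`-integrable and
`E_{P_N}[A_N] + B ≤ ε` — the clamp-renormalised local second law IN MEAN over the local Gibbs data, with the
initial entropy at its deterministic (Euler-data) value `B`. Why plausibly true: it is implied by the box-scale
hydrodynamic limit (isentropy of the classical solution gives `E[A_N] + B → 0`) and keeps only the ONE-SIDED half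
(unresolved fluctuations can only raise the concave clamped entropy budget in the direction BF18 allows); in global
equilibrium it holds with equality by S0 and the `v ↦ −v` symmetry. Why it might fail: no H-theorem for a
deterministic interacting gas — the local form needs the entropy flux to be `Z(s)m̂` with no Euler-order heat
current, i.e. weak local equilibrium IN MEAN at positive times (the crux's own risk, now isolated from S0/S2).
Integrability: `|A_N| ≲ (|a|∨|b|)(τ‖∂ₜφ‖_∞ + ‖φ_τ‖_∞ + τ‖∇φ‖_∞ (N+1)⁻¹Σ‖vᵢ‖)`, finite mean by energy
conservation and Maxwellian data; measurability of `z ↦ A_N(z)` via `HardSphereFlow.measurable_flow`.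
Sources: BrezinaFeireisl2018 Def. 2.9/§3.2, Spohn1991 §3.3, OllaVaradhanYau1993, KipnisLandim1999 Ch. 6. -/
def Sig.stub_meanEntropyInequality : Prop :=
  BoxDissipativeWeakStrong.HsEosLowDensity →
    ∃ ηc : ℝ, 0 < ηc ∧ ∀ η₁ : ℝ, 0 < η₁ → η₁ < ηc →
      ∀ (a₀ θ₀ : T3 → ℝ) (u₀ : T3 → V3), Continuous a₀ → Continuous θ₀ → Continuous u₀ →
        (∀ x, 0 < a₀ x) → (∀ x, 0 < θ₀ x) →
        ∃ σ₀ : ℝ, 0 < σ₀ ∧ ∀ σ : ℝ, 0 < σ → σ < σ₀ →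
          ∀ (T : ℝ) (ρ θ : ℝ → T3 → ℝ) (u : ℝ → T3 → V3), IsHardSphereEulerSolution σ T ρ u θ →
            (∀ t ∈ Ico 0 T, ∀ x, ρ t x * σ ^ 3 ≤ η₁ / 2) →
            ∀ Φ : FlowFamily σ,
              TendstoHydroFieldsAt (fun N => localGibbsLaw σ a₀ u₀ θ₀ N (Φ N)) Φ ρ u θ 0 →
              ∀ ℓ : ℕ → ℝ, (∀ N, 0 < ℓ N ∧ ℓ N ≤ 1) → Tendsto ℓ atTop (𝓝 0) →
                Tendsto (fun N : ℕ => ℓ N ^ 3 * ((N : ℝ) + 1)) atTop atTop →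
                ∀ τ ∈ Ico 0 T, ∀ a b : ℝ, a < b → ∀ φ : ℝ → T3 → ℝ,
                  Literature.Analysis.FunctionSpaces.Torus.IsSmoothSpaceTimeOn (Ico 0 T) φ →
                  (∀ t ∈ Icc 0 τ, ∀ x, 0 ≤ φ t x) →
                  ∀ ε : ℝ, 0 < ε → ∀ᶠ N : ℕ in atTop,
                    Integrable (dynPart σ η₁ T ℓ Φ τ a b φ N) (localGibbsLaw σ a₀ u₀ θ₀ N (Φ N)) ∧
                      (∫ z, dynPart σ η₁ T ℓ Φ τ a b φ N z ∂(localGibbsLaw σ a₀ u₀ θ₀ N (Φ N))) +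
                          initLimit σ η₁ ρ θ a b φ ≤ ε

/-- **S2 — no anomalous entropy fluctuations (positive-time law of large numbers; open).** In the crux's frame,
the dynamic part concentrates at its mean in `L¹(P_N)`: `E_{P_N} |A_N − E_{P_N}[A_N]| → 0` (Bochner mean; S1 makes
it the true mean eventually). Why plausibly true: `A_N` is a macroscopic space–time average of bounded-Lipschitz
(clamped) local functionals of the box fields weighted by `ρ̂` and `m̂`; at `t = 0` it is a LLN under the local
Gibbs law (correlation length `≍ (N+1)^{-1/3} ≪ ℓ_N`), and at positive times it follows from the box-scale
hydrodynamic limit with uniform integrability — but it asks for much less (no limit is identified: centred,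
functional-level concentration only). Why it might fail: the deterministic dynamics could in principle build
`O(1)` macroscopic randomness of the coarse-grained entropy before `T` (a random sub-shock structure invisible to
the conserved fields' means); no mixing input is available (BoltzmannHypothesis barrier family, at the level of
fluctuations). Sources: Spohn1991 §2.3/§3.3, OllaVaradhanYau1993 §1, KipnisLandim1999, ChenFrid2000. -/
def Sig.stub_entropyBalanceConcentration : Prop :=
  BoxDissipativeWeakStrong.HsEosLowDensity →
    ∃ ηc : ℝ, 0 < ηc ∧ ∀ η₁ : ℝ, 0 < η₁ → η₁ < ηc →
      ∀ (a₀ θ₀ : T3 → ℝ) (u₀ : T3 → V3), Continuous a₀ → Continuous θ₀ → Continuous u₀ →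
        (∀ x, 0 < a₀ x) → (∀ x, 0 < θ₀ x) →
        ∃ σ₀ : ℝ, 0 < σ₀ ∧ ∀ σ : ℝ, 0 < σ → σ < σ₀ →
          ∀ (T : ℝ) (ρ θ : ℝ → T3 → ℝ) (u : ℝ → T3 → V3), IsHardSphereEulerSolution σ T ρ u θ →
            (∀ t ∈ Ico 0 T, ∀ x, ρ t x * σ ^ 3 ≤ η₁ / 2) →
            ∀ Φ : FlowFamily σ,
              TendstoHydroFieldsAt (fun N => localGibbsLaw σ a₀ u₀ θ₀ N (Φ N)) Φ ρ u θ 0 →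
              ∀ ℓ : ℕ → ℝ, (∀ N, 0 < ℓ N ∧ ℓ N ≤ 1) → Tendsto ℓ atTop (𝓝 0) →
                Tendsto (fun N : ℕ => ℓ N ^ 3 * ((N : ℝ) + 1)) atTop atTop →
                ∀ τ ∈ Ico 0 T, ∀ a b : ℝ, a < b → ∀ φ : ℝ → T3 → ℝ,
                  Literature.Analysis.FunctionSpaces.Torus.IsSmoothSpaceTimeOn (Ico 0 T) φ →
                  (∀ t ∈ Icc 0 τ, ∀ x, 0 ≤ φ t x) →
                  Tendsto (fun N : ℕ => ∫⁻ z, ENNReal.ofReal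
                      |dynPart σ η₁ T ℓ Φ τ a b φ N z -
                        ∫ z', dynPart σ η₁ T ℓ Φ τ a b φ N z' ∂(localGibbsLaw σ a₀ u₀ θ₀ N (Φ N))|
                    ∂(localGibbsLaw σ a₀ u₀ θ₀ N (Φ N))) atTop (𝓝 0)

/-- **S0a — modulus of continuity of the clamped cut entropy (deterministic; size S–M, provable now).**
If the excess free energy is continuous on `[0, η₀)` (supplied from `HsEosLowDensity` by S0b), then for
`0 < σ`, `0 < η₁ < η₀`, reals `a, b` and every COMPACT set `K` of states `p = (r, m, e)` in the physical band
(`0 < r`, `r σ³ < η₁`, `0 < θ̂(p)`), the map `G(q) = Z_{a,b}(s_cut(q.1, θ̂(q)))` has a modulus of continuity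
uniform over base points in `K`: `∀ ε > 0 ∃ δ > 0 ∀ p ∈ K ∀ q, dist q p < δ → |G q − G p| < ε`. Why true: `G` is
continuous on the OPEN set `V = {0 < r, rσ³ < η₁, 0 < θ̂}` (`log` off `0`, `θ̂` off `r = 0`, `f_ex ∘ min(·, η₁)`
at interior points of `[0,η₀)`, `log (max η η₁ / η₁)` with argument `≥ 1`), `K ⊆ V` compact, so some closed
`δ₁`-thickening of `K` is a compact subset of `V` (`IsCompact.exists_cthickening_subset_open`) on which `G` is
uniformly continuous. Leans on: Mathlib only (+ `BDWS.boxTemp`, `BDWS.cutEntropy`, `CompressibleEuler.clamp`). -/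
def Sig.stub_entropyModulus : Prop :=
  ∀ η₀ : ℝ, 0 < η₀ → ContinuousOn hsExcessFreeEnergy (Ico 0 η₀) →
    ∀ (σ η₁ a b : ℝ), 0 < σ → 0 < η₁ → η₁ < η₀ →
      ∀ K : Set (ℝ × V3 × ℝ), IsCompact K →
        (∀ p ∈ K, 0 < p.1 ∧ p.1 * σ ^ 3 < η₁ ∧ 0 < boxTemp p.1 p.2.1 p.2.2) →
        ∀ ε : ℝ, 0 < ε → ∃ δ : ℝ, 0 < δ ∧ ∀ p ∈ K, ∀ q : ℝ × V3 × ℝ, dist q p < δ →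
          |clamp a b (cutEntropy σ η₁ q.1 (boxTemp q.1 q.2.1 q.2.2)) -
              clamp a b (cutEntropy σ η₁ p.1 (boxTemp p.1 p.2.1 p.2.2))| < ε

/-- **S0b — the initial entropy LLN from the modulus (measure theory; size M, provable now).**
`Sig.stub_entropyModulus → Sig.stub_initialEntropyLLN`. Why true: take `ηc := η₀` of `HsEosLowDensity`
(which also gives `ContinuousOn hsExcessFreeEnergy (Ico 0 η₀)`), `σ₀ := min σ₀^{LGFS}(a₀,θ₀,u₀) (1/2)`;
`0 < T` from `τ ∈ [0,T)`; `ρ(0,·), θ(0,·) > 0` continuous, so `K = range (x ↦ (ρ, ρ•u, E(ρ,u,θ))(0,x))` is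
compact in the band with `θ̂ = θ(0,x) > 0` (`BDWS.boxTemp_consState`); with `M = max |a| |b|`
(`CompressibleEuler.abs_clamp_le`), `R = sup ρ(0,·)`, `Φ∞ = sup |φ(0,·)|` and the `δ` of S0a at `ε`:
pointwise in `x`, `|ρ̂ Z(ŝ) − ρ₀ Z(s₀)| |φ₀| ≤ Φ∞ ((M + 2MR/δ) dev + R ε)` where
`dev = |ρ̂−ρ₀| + ‖m̂−ρ₀u₀‖ + |Ê−E₀| ≥ dist`, the box fields are measurable and bounded in `x`
(`LGFS.measurable_empirical*Field_param`, `measurable_boxK_uncurry`, `0 ≤ ρ̂ ≤ ℓ⁻³`), and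
`E_P ofReal (∫ dev dx) → 0` is `LGFS.localGibbsFineScale_of_pos` verbatim (`BDWS.boxDensity … 0 z x` unfolds to
its `Dn N 0 z x`); conclude with `ε → 0`. Leans on: `Theorems.LGFS.localGibbsFineScale_of_pos`,
`isProbabilityMeasure_localGibbsLaw`, `HsEosLowDensity` (hypothesis of the frame). -/
def Sig.stub_initialEntropyLLN_of_modulus : Prop :=
  Sig.stub_entropyModulus → Sig.stub_initialEntropyLLN

/-- **S1a — integrability of the dynamic part (measure theory; size M–L, provable now).** In the crux's frame,
`A_N = dynPart … N ∈ L¹(P_N)` for every `N`. Why true: a.e.-strong measurability of `z ↦ A_N(z)` from the joint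
measurability of `(s, z) ↦ Φ_s z` on `Φ.good × ℝ` (`HardSphereFlow.measurable_flow_prod_torus`; the good set is
conull for `P_N = localGibbsMeasure ≪ Liouville`, `localGibbsLaw_eq`, `localGibbsMeasure_absolutelyContinuous`)
and the joint measurability of the box fields in `(z, x)` (`LGFS.measurable_empirical*Field_param`); the
bound `|A_N(z)| ≤ M(τ‖∂ₜφ‖_∞ + ‖φ_τ‖_∞) + M τ ‖∇φ‖_∞ (1/2 + (N+1)⁻¹ configEnergy z)` on the good set
(`∫ K_ℓ(x,y) dx = 1`, `‖v‖ ≤ (1 + ‖v‖²)/2`, energy conservation `HardSphereFlow.configEnergy_flow`), and the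
finite Maxwellian second moment of `(N+1)⁻¹ configEnergy` under the local Gibbs measure. On `[0, η₁]` the
`limsup`-defined `f_ex` equals the analytic `F` of `HsEosLowDensity` (take `ηc ≤ η₀`), so the clamped entropy is
a measurable function of the box fields. Leans on: `HardSphereFlowJointMeasurable`, `HardSphereEulerProofs`
(`lintegral_localGibbsMeasure`, Gaussian moments), torus calculus sup bounds for smooth `φ` on `[0,τ] × 𝕋³`. -/
def Sig.stub_dynPartIntegrable : Prop :=
  BoxDissipativeWeakStrong.HsEosLowDensity →
    ∃ ηc : ℝ, 0 < ηc ∧ ∀ η₁ : ℝ, 0 < η₁ → η₁ < ηc →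
      ∀ (a₀ θ₀ : T3 → ℝ) (u₀ : T3 → V3), Continuous a₀ → Continuous θ₀ → Continuous u₀ →
        (∀ x, 0 < a₀ x) → (∀ x, 0 < θ₀ x) →
        ∃ σ₀ : ℝ, 0 < σ₀ ∧ ∀ σ : ℝ, 0 < σ → σ < σ₀ →
          ∀ (T : ℝ) (ρ θ : ℝ → T3 → ℝ) (u : ℝ → T3 → V3), IsHardSphereEulerSolution σ T ρ u θ →
            (∀ t ∈ Ico 0 T, ∀ x, ρ t x * σ ^ 3 ≤ η₁ / 2) →
            ∀ Φ : FlowFamily σ,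
              TendstoHydroFieldsAt (fun N => localGibbsLaw σ a₀ u₀ θ₀ N (Φ N)) Φ ρ u θ 0 →
              ∀ ℓ : ℕ → ℝ, (∀ N, 0 < ℓ N ∧ ℓ N ≤ 1) → Tendsto ℓ atTop (𝓝 0) →
                Tendsto (fun N : ℕ => ℓ N ^ 3 * ((N : ℝ) + 1)) atTop atTop →
                ∀ τ ∈ Ico 0 T, ∀ a b : ℝ, a < b → ∀ φ : ℝ → T3 → ℝ,
                  Literature.Analysis.FunctionSpaces.Torus.IsSmoothSpaceTimeOn (Ico 0 T) φ →
                  (∀ t ∈ Icc 0 τ, ∀ x, 0 ≤ φ t x) →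
                  ∀ N : ℕ, Integrable (dynPart σ η₁ T ℓ Φ τ a b φ N) (localGibbsLaw σ a₀ u₀ θ₀ N (Φ N))

/-- **S1b — the annealed local entropy DEFICIT bound (dynamics; THE HEART, open problem).** In the crux's
frame: for every `ε > 0`, eventually in `N`, `E_{P_N}[A_N] + B ≤ ε` (Bochner mean; S1a makes it the true mean).
This is S1 minus its integrability conjunct — the clamp-renormalised local second law IN MEAN over the local
Gibbs data, with the initial entropy at its deterministic Euler value `B`. Why plausibly true / why it might
fail: verbatim as for S1 (isentropy of the classical solution gives `E[A_N] + B → 0` under the box-scale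
hydrodynamic limit; no H-theorem substitute for a deterministic interacting gas is known — weak local
equilibrium in mean at positive times). Sources: BrezinaFeireisl2018 Def. 2.9/§3.2, Spohn1991 §3.3,
OllaVaradhanYau1993, KipnisLandim1999 Ch. 6. -/
def Sig.stub_meanEntropyDeficit : Prop :=
  BoxDissipativeWeakStrong.HsEosLowDensity →
    ∃ ηc : ℝ, 0 < ηc ∧ ∀ η₁ : ℝ, 0 < η₁ → η₁ < ηc →
      ∀ (a₀ θ₀ : T3 → ℝ) (u₀ : T3 → V3), Continuous a₀ → Continuous θ₀ → Continuous u₀ →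
        (∀ x, 0 < a₀ x) → (∀ x, 0 < θ₀ x) →
        ∃ σ₀ : ℝ, 0 < σ₀ ∧ ∀ σ : ℝ, 0 < σ → σ < σ₀ →
          ∀ (T : ℝ) (ρ θ : ℝ → T3 → ℝ) (u : ℝ → T3 → V3), IsHardSphereEulerSolution σ T ρ u θ →
            (∀ t ∈ Ico 0 T, ∀ x, ρ t x * σ ^ 3 ≤ η₁ / 2) →
            ∀ Φ : FlowFamily σ,
              TendstoHydroFieldsAt (fun N => localGibbsLaw σ a₀ u₀ θ₀ N (Φ N)) Φ ρ u θ 0 →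
              ∀ ℓ : ℕ → ℝ, (∀ N, 0 < ℓ N ∧ ℓ N ≤ 1) → Tendsto ℓ atTop (𝓝 0) →
                Tendsto (fun N : ℕ => ℓ N ^ 3 * ((N : ℝ) + 1)) atTop atTop →
                ∀ τ ∈ Ico 0 T, ∀ a b : ℝ, a < b → ∀ φ : ℝ → T3 → ℝ,
                  Literature.Analysis.FunctionSpaces.Torus.IsSmoothSpaceTimeOn (Ico 0 T) φ →
                  (∀ t ∈ Icc 0 τ, ∀ x, 0 ≤ φ t x) →
                  ∀ ε : ℝ, 0 < ε → ∀ᶠ N : ℕ in atTop,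
                    (∫ z, dynPart σ η₁ T ℓ Φ τ a b φ N z ∂(localGibbsLaw σ a₀ u₀ θ₀ N (Φ N))) +
                        initLimit σ η₁ ρ θ a b φ ≤ ε

/-- **S2a — positive-time box concentration (open; reshape r2, typed by worker S2 and widened to linear growth).**
For continuous positive profiles, `σ < σ₀(profiles)`, every classical hs-Euler solution on `[0,T)`, every flow family with the
`t = 0` LLN and every kinetic window: at each FIXED `t ∈ [0,T)`, for every Borel `G : ℝ × V3 × ℝ → ℝ` of linear growth
`|G(r,m,e)| ≤ |r| + ‖m‖` and every continuous `ψ : 𝕋³ → ℝ`, the box functional `z ↦ ∫ G(ρ̂, m̂, Ê)(t,z,x) ψ(x) dx` concentrates at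
its Bochner mean in `L¹(P_N)`. No limit is identified (strictly weaker than a box-scale hydrodynamic limit); TRUE at `t = 0`
(two-point statics of the local Gibbs law, cf. the landed LGFS files) and for constant profiles (flow-invariance); OPEN otherwise —
no mixing input for deterministic hard spheres (BoltzmannHypothesis / MacroErgodicity barrier family at the level of fluctuations;
the entropy method bounds only events of Gibbs-rate `> O(1)`, never `δ`-deviations about a moving mean). The route header's
foreseen child `PositiveTimeBoxConcentration`; o(1)/box-scale twin of SwapGap's `stub_detFieldConcentration`. Sources:
Spohn1991 §2.3/§3.3, OllaVaradhanYau1993 §1, KipnisLandim1999. -/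
def Sig.stub_positiveTimeBoxConcentration : Prop :=
  ∀ (a₀ θ₀ : T3 → ℝ) (u₀ : T3 → V3), Continuous a₀ → Continuous θ₀ → Continuous u₀ →
    (∀ x, 0 < a₀ x) → (∀ x, 0 < θ₀ x) →
    ∃ σ₀ : ℝ, 0 < σ₀ ∧ ∀ σ : ℝ, 0 < σ → σ < σ₀ →
      ∀ (T : ℝ) (ρ θ : ℝ → T3 → ℝ) (u : ℝ → T3 → V3), IsHardSphereEulerSolution σ T ρ u θ →
        ∀ Φ : FlowFamily σ,
          TendstoHydroFieldsAt (fun N => localGibbsLaw σ a₀ u₀ θ₀ N (Φ N)) Φ ρ u θ 0 →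
          ∀ ℓ : ℕ → ℝ, (∀ N, 0 < ℓ N ∧ ℓ N ≤ 1) → Tendsto ℓ atTop (𝓝 0) →
            Tendsto (fun N : ℕ => ℓ N ^ 3 * ((N : ℝ) + 1)) atTop atTop →
            ∀ t ∈ Ico 0 T, ∀ G : ℝ × V3 × ℝ → ℝ, Measurable G → (∀ p, |G p| ≤ |p.1| + ‖p.2.1‖) →
              ∀ ψ : T3 → ℝ, Continuous ψ →
                Tendsto (fun N : ℕ => ∫⁻ z, ENNReal.ofReal
                    |(∫ x, G (boxDensity σ ℓ Φ N t z x, boxMomentum σ ℓ Φ N t z x,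
                        boxEnergy σ ℓ Φ N t z x) * ψ x) -
                      ∫ z', (∫ x, G (boxDensity σ ℓ Φ N t z' x, boxMomentum σ ℓ Φ N t z' x,
                        boxEnergy σ ℓ Φ N t z' x) * ψ x) ∂(localGibbsLaw σ a₀ u₀ θ₀ N (Φ N))|
                  ∂(localGibbsLaw σ a₀ u₀ θ₀ N (Φ N))) atTop (𝓝 0)

/-- **S2b — S2 from positive-time box concentration (measure theory; size L, provable now).**
`Sig.stub_positiveTimeBoxConcentration → Sig.stub_entropyBalanceConcentration`. Why true: write
`A_N = ∫_{(0,τ]} g_N(t,·) dt − k_N` with `g_N(t,z) = ∫ (G₁(Û) ∂ₜφ + Σ_k G₂ₖ(Û) ∂ₖφ)(t,x) dx`, `k_N(z) = ∫ G₁(Û_τ) φ_τ dx`,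
`G₁(r,m,e) = r⁺ Z_{a,b}(s_cut(r⁺, θ̂(r⁺,m,e)))`, `G₂ₖ = Z_{a,b}(…) m_k` (`r⁺ = max r 0`; on box fields `r = ρ̂ ≥ 0`, so nothing changes;
Borel because `f_ex` is only evaluated on `[0, η₁] ⊆ [0, η₀)`, `ηc := η₀`; linear growth with constant `M = |a| ∨ |b|`), apply S2a at
each fixed `t ∈ (0,τ] ∪ {τ} ⊆ [0,T)` to `G/M` with the continuous slices `∂ₜφ(t,·)`, `∂ₖφ(t,·)`, `φ(τ,·)`; Fubini on `P_N ⊗ dt|_{(0,τ]}`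
(joint measurability and the bound `|g_N(t,z)| ≤ A + B·configEnergy z` from the landed S1a toolbox `EABirthS1a.*`); dominated
convergence in `t` with the `t`- and `N`-uniform dominator `2 sup E|g_N(t)| ≤ C(1 + sup_N E_{P_N}[(N+1)⁻¹ KE])` (Maxwellian second
moments, energy conservation). Leans on: EABirthS1a (statBulk/statBdry, measurability, bounds), HardSphereFlowJointMeasurable,
AWS.lintegral_energy_sq_le, torus calculus slices. -/
def Sig.stub_entropyBalanceConcentration_of_PTBC : Prop :=
  Sig.stub_positiveTimeBoxConcentration → Sig.stub_entropyBalanceConcentration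

/-- **S2a' — positive-time box concentration IN THE BAND (open; reshape r6 = S2a weakened to the crux's own frame).**
Worker S2a's audit (wave 2, evidence `S2a-audit.md` §3(ii)): S2a as typed quantifies over classical solutions of the
`limsup`/`deriv` equation of state at ALL densities reached before `T`; the composition only ever consumes it under the
crux's EOS fact, band `η₁ < η_c` and packing guard `ρσ³ ≤ η₁/2`. S2a' asks the same fixed-time `L¹(P_N)`-concentration of
`z ↦ ∫ G(ρ̂, m̂, Ê)(t,z,x) ψ(x) dx` about its Bochner mean (Borel `G` of linear growth, continuous `ψ`, every `t ∈ [0,T)`),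
but only in that frame — strictly fewer instances, same open content (positive-time box-scale self-averaging of
deterministic hard spheres from local Gibbs data; true at `t = 0` and along constant profiles, LANDED reductions
`EABirthS2aPre.*`, p156703). Sources: Spohn1991 §2.3/§3.3, OllaVaradhanYau1993 §1, KipnisLandim1999. -/
def Sig.stub_positiveTimeBoxConcentrationInBand : Prop :=
  BoxDissipativeWeakStrong.HsEosLowDensity →
    ∃ ηc : ℝ, 0 < ηc ∧ ∀ η₁ : ℝ, 0 < η₁ → η₁ < ηc →
      ∀ (a₀ θ₀ : T3 → ℝ) (u₀ : T3 → V3), Continuous a₀ → Continuous θ₀ → Continuous u₀ →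
        (∀ x, 0 < a₀ x) → (∀ x, 0 < θ₀ x) →
        ∃ σ₀ : ℝ, 0 < σ₀ ∧ ∀ σ : ℝ, 0 < σ → σ < σ₀ →
          ∀ (T : ℝ) (ρ θ : ℝ → T3 → ℝ) (u : ℝ → T3 → V3), IsHardSphereEulerSolution σ T ρ u θ →
            (∀ t ∈ Ico 0 T, ∀ x, ρ t x * σ ^ 3 ≤ η₁ / 2) →
            ∀ Φ : FlowFamily σ,
              TendstoHydroFieldsAt (fun N => localGibbsLaw σ a₀ u₀ θ₀ N (Φ N)) Φ ρ u θ 0 →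
              ∀ ℓ : ℕ → ℝ, (∀ N, 0 < ℓ N ∧ ℓ N ≤ 1) → Tendsto ℓ atTop (𝓝 0) →
                Tendsto (fun N : ℕ => ℓ N ^ 3 * ((N : ℝ) + 1)) atTop atTop →
                ∀ t ∈ Ico 0 T, ∀ G : ℝ × V3 × ℝ → ℝ, Measurable G → (∀ p, |G p| ≤ |p.1| + ‖p.2.1‖) →
                  ∀ ψ : T3 → ℝ, Continuous ψ →
                    Tendsto (fun N : ℕ => ∫⁻ z, ENNReal.ofReal
                        |(∫ x, G (boxDensity σ ℓ Φ N t z x, boxMomentum σ ℓ Φ N t z x,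
                            boxEnergy σ ℓ Φ N t z x) * ψ x) -
                          ∫ z', (∫ x, G (boxDensity σ ℓ Φ N t z' x, boxMomentum σ ℓ Φ N t z' x,
                            boxEnergy σ ℓ Φ N t z' x) * ψ x) ∂(localGibbsLaw σ a₀ u₀ θ₀ N (Φ N))|
                      ∂(localGibbsLaw σ a₀ u₀ θ₀ N (Φ N))) atTop (𝓝 0)

/-- **S2b' — S2 from the in-band concentration (measure theory; provable now, = the landed S2b proof with the guard passed
through; reshape r6).** `Sig.stub_positiveTimeBoxConcentrationInBand → Sig.stub_entropyBalanceConcentration`. -/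
def Sig.stub_entropyBalanceConcentration_of_PTBCInBand : Prop :=
  Sig.stub_positiveTimeBoxConcentrationInBand → Sig.stub_entropyBalanceConcentration

/-- **DynCore — the dynamic core of the crux (reshape r4; EQUIVALENT to the crux over the landed S0, hence open).**
In the crux's frame: `E_{P_N}[(A_N + B)⁺] → 0` (outer integral `∫⁻ ofReal`), i.e. the crux with the random initial
entropy `B_N` replaced by its deterministic Euler value `B = initLimit`. It sits between the two open stubs' targets:
`DynCore → S1b` (mean half) and `S1b → S2 → DynCore` (S2 = fluctuation half = S2b ∘ S2a). Not a registered obligation by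
itself (it is the crux minus statics); named here only to state the sandwich stub below. -/
def Sig.stub_dynamicCore : Prop :=
  BoxDissipativeWeakStrong.HsEosLowDensity →
    ∃ ηc : ℝ, 0 < ηc ∧ ∀ η₁ : ℝ, 0 < η₁ → η₁ < ηc →
      ∀ (a₀ θ₀ : T3 → ℝ) (u₀ : T3 → V3), Continuous a₀ → Continuous θ₀ → Continuous u₀ →
        (∀ x, 0 < a₀ x) → (∀ x, 0 < θ₀ x) →
        ∃ σ₀ : ℝ, 0 < σ₀ ∧ ∀ σ : ℝ, 0 < σ → σ < σ₀ →
          ∀ (T : ℝ) (ρ θ : ℝ → T3 → ℝ) (u : ℝ → T3 → V3), IsHardSphereEulerSolution σ T ρ u θ →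
            (∀ t ∈ Ico 0 T, ∀ x, ρ t x * σ ^ 3 ≤ η₁ / 2) →
            ∀ Φ : FlowFamily σ,
              TendstoHydroFieldsAt (fun N => localGibbsLaw σ a₀ u₀ θ₀ N (Φ N)) Φ ρ u θ 0 →
              ∀ ℓ : ℕ → ℝ, (∀ N, 0 < ℓ N ∧ ℓ N ≤ 1) → Tendsto ℓ atTop (𝓝 0) →
                Tendsto (fun N : ℕ => ℓ N ^ 3 * ((N : ℝ) + 1)) atTop atTop →
                ∀ τ ∈ Ico 0 T, ∀ a b : ℝ, a < b → ∀ φ : ℝ → T3 → ℝ,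
                  Literature.Analysis.FunctionSpaces.Torus.IsSmoothSpaceTimeOn (Ico 0 T) φ →
                  (∀ t ∈ Icc 0 τ, ∀ x, 0 ≤ φ t x) →
                  Tendsto (fun N : ℕ => ∫⁻ z, ENNReal.ofReal
                      (dynPart σ η₁ T ℓ Φ τ a b φ N z + initLimit σ η₁ ρ θ a b φ)
                    ∂(localGibbsLaw σ a₀ u₀ θ₀ N (Φ N))) atTop (𝓝 0)

/-- **Sandwich stub (r4; bookkeeping over landed theorems, size S, provable now — lands the tightness of the cut).**
`(crux ↔ DynCore) ∧ (DynCore → S1b) ∧ (S1b → S2 → DynCore)`: the crux is its dynamic core; the core implies the open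
heart S1b (`E[A]+B = E[A+B] ≤ E[(A+B)⁺]`, S1a) and follows from S1b with the fluctuation statement S2
(`(A+B)⁺ ≤ |A − E A| + (E A + B)⁺`); `crux ↔ DynCore` by `(A+B)⁺ ≤ (A+B_N)⁺ + |B_N − B|` and conversely (S0).
Leans on: landed S0 (p148838, p149919), S1a (p150196), `EABirthS1bNec.eventually_integral_add_const_le` (p153795). -/
def Sig.stub_dynamicCoreSandwich : Prop :=
  (BoxDissipativeWeakStrong.EntropyAdmissibility ↔ Sig.stub_dynamicCore) ∧
    (Sig.stub_dynamicCore → Sig.stub_meanEntropyDeficit) ∧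
    (Sig.stub_meanEntropyDeficit → Sig.stub_entropyBalanceConcentration → Sig.stub_dynamicCore)

/-- **Composition stub (r6; bookkeeping, size XS, provable now — puts the line's composition INTO THE TREE).**
`S1b → S2a' → crux`: the conditional form of the crux over its two open stubs (landed sandwich + S2b'). A re-lining of
stmt-9903 into the route header's foreseen children `MeanLocalEntropyInequality` (= S1b) and `PositiveTimeBoxConcentration`
(= S2a') cites exactly this theorem. -/
def Sig.stub_cruxOfOpenStubs : Prop :=
  Sig.stub_meanEntropyDeficit → Sig.stub_positiveTimeBoxConcentrationInBand →
    BoxDissipativeWeakStrong.EntropyAdmissibility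

/-- **GCH — the global clamped H-theorem in mean (r7; NECESSARY for the crux, open; the sharpest honest sub-target).**
Testing the crux with space-homogeneous `φ(t,x) = χ(t)` kills the flux term; the dynamic part becomes
`A_N = ∫_{(0,τ]} S_N(t) χ'(t) dt − S_N(τ) χ(τ)` with the clamped COARSE-GRAINED entropy `S_N(t)(z) = ∫ ρ̂ Z_{a,b}(ŝ) dx`.
GCH: in the crux's frame, for every smooth `χ ≥ 0` on `[0,τ]`, `∀ ε > 0`, eventually
`E_{P_N}[∫_{(0,τ]} S_N χ' dt − S_N(τ) χ(τ)] + S(0) χ(0) ≤ ε` (`S(0) = ∫ ρ₀ Z(s₀)`): with `χ` increasing on `[t₁,t₂]` and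
constant afterwards, `E S_N(τ) ≥ (weighted mean of E S_N over [t₁,t₂]) − o(1)` — asymptotic MONOTONICITY of the expected
clamped coarse-grained entropy between two POSITIVE times for deterministic hard spheres from local Gibbs data (an annealed,
clamped, coarse-grained H-theorem). Why it might fail / why open: no tool gives monotonicity between positive times (the Gibbs
variational principle restarts only at `t = 0`, where the law is local Gibbs; the lower clamp breaks concavity, so even
Jensen-type comparisons of `E[ρ̂ Z(ŝ)]` with the entropy of the mean fields fail). Refuting GCH refutes the crux. -/
def Sig.globalClampedHTheorem : Prop :=
  BoxDissipativeWeakStrong.HsEosLowDensity →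
    ∃ ηc : ℝ, 0 < ηc ∧ ∀ η₁ : ℝ, 0 < η₁ → η₁ < ηc →
      ∀ (a₀ θ₀ : T3 → ℝ) (u₀ : T3 → V3), Continuous a₀ → Continuous θ₀ → Continuous u₀ →
        (∀ x, 0 < a₀ x) → (∀ x, 0 < θ₀ x) →
        ∃ σ₀ : ℝ, 0 < σ₀ ∧ ∀ σ : ℝ, 0 < σ → σ < σ₀ →
          ∀ (T : ℝ) (ρ θ : ℝ → T3 → ℝ) (u : ℝ → T3 → V3), IsHardSphereEulerSolution σ T ρ u θ →
            (∀ t ∈ Ico 0 T, ∀ x, ρ t x * σ ^ 3 ≤ η₁ / 2) →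
            ∀ Φ : FlowFamily σ,
              TendstoHydroFieldsAt (fun N => localGibbsLaw σ a₀ u₀ θ₀ N (Φ N)) Φ ρ u θ 0 →
              ∀ ℓ : ℕ → ℝ, (∀ N, 0 < ℓ N ∧ ℓ N ≤ 1) → Tendsto ℓ atTop (𝓝 0) →
                Tendsto (fun N : ℕ => ℓ N ^ 3 * ((N : ℝ) + 1)) atTop atTop →
                ∀ τ ∈ Ico 0 T, ∀ a b : ℝ, a < b → ∀ χ : ℝ → ℝ, ContDiffOn ℝ ∞ χ (Ico 0 T) →
                  (∀ t ∈ Icc 0 τ, 0 ≤ χ t) →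
                  ∀ ε : ℝ, 0 < ε → ∀ᶠ N : ℕ in atTop,
                    (∫ z, ((∫ t in Ioc 0 τ, (∫ x, boxDensity σ ℓ Φ N t z x * boxClampedEntropy σ η₁ ℓ Φ a b N t z x) *
                          derivWithin χ (Ico 0 T) t) -
                        (∫ x, boxDensity σ ℓ Φ N τ z x * boxClampedEntropy σ η₁ ℓ Φ a b N τ z x) * χ τ)
                      ∂(localGibbsLaw σ a₀ u₀ θ₀ N (Φ N))) +
                      (∫ x, ρ 0 x * clamp a b (cutEntropy σ η₁ (ρ 0 x) (θ 0 x))) * χ 0 ≤ ε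

/-- **GCH is necessary (r7; bookkeeping over the landed sandwich, size S, provable now).**
`(crux → GCH) ∧ (S1b → GCH)`: instantiate S1b at `φ = χ ∘ fst` (`∇φ = 0`, `∂ₜφ = χ'`), and `crux → S1b` (sandwich). -/
def Sig.stub_globalClampedHTheoremNecessary : Prop :=
  (BoxDissipativeWeakStrong.EntropyAdmissibility → Sig.globalClampedHTheorem) ∧
    (Sig.stub_meanEntropyDeficit → Sig.globalClampedHTheorem)

/-! ### r9 — the global-equilibrium sub-frame (lead c2) -/

/- (r10: now the tree's `EABirthGE3.InFrameConst`, landed p162417; text kept for the record)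
**The GLOBAL-EQUILIBRIUM sub-frame** applied to a conclusion `C : EABirthCore.Conclusion`: the crux's quantifier frame
`EABirthCore.InFrame` with the six profile / solution fields specialised to CONSTANTS — activity `a₀ ≡ ca`, temperature
`θ₀ ≡ cθ`, velocity `u₀ ≡ cu` (so `P_N` is the canonical GLOBAL Gibbs law, invariant under every hard-sphere flow:
`map_flow_localGibbsLaw_const`) and Euler state `(ρ, u, θ) ≡ (cρ, cv, cϑ)` (a constant state is a classical solution iff
`cρ, cϑ > 0`; by classical uniqueness it is THE solution from constant data, but uniqueness is not used: the sub-frame simply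
quantifies over constant solutions). Binders otherwise verbatim (`InFrame C → InFrameConst C`, `InFrameConst.of_inFrame`).
  def InFrameConst (C : Conclusion) : Prop :=
  BoxDissipativeWeakStrong.HsEosLowDensity →
    ∃ ηc : ℝ, 0 < ηc ∧ ∀ η₁ : ℝ, 0 < η₁ → η₁ < ηc →
      ∀ (ca cθ : ℝ) (cu : V3), 0 < ca → 0 < cθ →
        ∃ σ₀ : ℝ, 0 < σ₀ ∧ ∀ σ : ℝ, 0 < σ → σ < σ₀ →
          ∀ (T cρ cϑ : ℝ) (cv : V3),
            IsHardSphereEulerSolution σ T (fun _ _ => cρ) (fun _ _ => cv) (fun _ _ => cϑ) →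
            (∀ t ∈ Ico 0 T, ∀ _x : T3, cρ * σ ^ 3 ≤ η₁ / 2) →
            ∀ Φ : FlowFamily σ,
              TendstoHydroFieldsAt (fun N => localGibbsLaw σ (fun _ => ca) (fun _ => cu) (fun _ => cθ) N (Φ N)) Φ
                (fun _ _ => cρ) (fun _ _ => cv) (fun _ _ => cϑ) 0 →
              ∀ ℓ : ℕ → ℝ, (∀ N, 0 < ℓ N ∧ ℓ N ≤ 1) → Tendsto ℓ atTop (𝓝 0) →
                Tendsto (fun N : ℕ => ℓ N ^ 3 * ((N : ℝ) + 1)) atTop atTop →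
                ∀ τ ∈ Ico 0 T, ∀ a b : ℝ, a < b → ∀ φ : ℝ → T3 → ℝ,
                  Literature.Analysis.FunctionSpaces.Torus.IsSmoothSpaceTimeOn (Ico 0 T) φ →
                  (∀ t ∈ Icc 0 τ, ∀ x, 0 ≤ φ t x) →
                  C σ η₁ (fun _ => ca) (fun _ => cθ) (fun _ => cu) T (fun _ _ => cρ) (fun _ _ => cϑ) (fun _ _ => cv)
                    Φ ℓ τ a b φ
-/

/- (r10: now the tree's `EABirthGE1.Cge1`, landed p161002; text kept for the record)
**GE1's conclusion — static LLN for the two entropy functionals at `t = 0`** (general profiles): for every continuous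
scalar `ψ` and vector `Ψ` test datum, `E_{P_N}|∫ ρ̂₀ Z(ŝ₀) ψ dx − ∫ ρ₀ Z(s₀) ψ dx| → 0` and
`E_{P_N}|∫ Z(ŝ₀) m̂₀·Ψ dx − ∫ Z(s₀) ρ₀u₀·Ψ dx| → 0` (`s₀ = s_cut(ρ(0,x), θ(0,x))`, `Z = Z_{a,b}`). These are verbatim
the two summands of `EABirthS1a.statBulk` at flow-time `0`, so S0 is the instance `ψ = φ(0,·)`.
  def Cge1 : Conclusion := fun σ η₁ a₀ θ₀ u₀ _T ρ θ u Φ ℓ _τ a b _φ =>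
  (∀ ψ : T3 → ℝ, Continuous ψ →
    Tendsto (fun N : ℕ => ∫⁻ z, ENNReal.ofReal
        |(∫ x, boxDensity σ ℓ Φ N 0 z x * boxClampedEntropy σ η₁ ℓ Φ a b N 0 z x * ψ x) -
          ∫ x, ρ 0 x * clamp a b (cutEntropy σ η₁ (ρ 0 x) (θ 0 x)) * ψ x|
      ∂(localGibbsLaw σ a₀ u₀ θ₀ N (Φ N))) atTop (𝓝 0)) ∧
  (∀ Ψ : T3 → V3, Continuous Ψ →
    Tendsto (fun N : ℕ => ∫⁻ z, ENNReal.ofReal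
        |(∫ x, boxClampedEntropy σ η₁ ℓ Φ a b N 0 z x * inner ℝ (boxMomentum σ ℓ Φ N 0 z x) (Ψ x)) -
          ∫ x, clamp a b (cutEntropy σ η₁ (ρ 0 x) (θ 0 x)) * inner ℝ (ρ 0 x • u 0 x) (Ψ x)|
      ∂(localGibbsLaw σ a₀ u₀ θ₀ N (Φ N))) atTop (𝓝 0))
-/

/-- **GE1 — static LLN for the entropy functionals (statics at `t = 0`; size M–L, provable now — the S0b template).**
`InFrame Cge1`. Why true: as S0 (`EABirthS0b`): `Φ_0 = id` a.s., the landed fine-scale LLN `LGFS.localGibbsFineScale_of_pos`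
gives `E ∫ dev dx → 0`, `dev = |ρ̂−ρ₀| + ‖m̂−ρ₀u₀‖ + |Ê−E₀|`, the modulus S0a (`EABirthS0a.stub_entropyModulus`) of
`G = Z(s_cut(r, θ̂))` relative to the compact set of Euler data states gives `|G(Û) − G(U₀)| ≤ ε + (2M/δ) dev`
(`EABirthS0b.abs_sub_le_of_modulus`), whence `|ρ̂ G(Û) ψ − ρ₀ G(U₀) ψ| ≤ ‖ψ‖_∞((M + 2MR/δ) dev + R ε)` and, for the flux
functional, `|G(Û) m̂·Ψ − G(U₀) m₀·Ψ| ≤ ‖Ψ‖_∞ (ε (R_m + 1) + (2M (R_m/δ + 1) + M) dev)` (split on `dist(Û, U₀) < δ ≤ 1`,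
where `‖m̂‖ ≤ R_m + 1`, versus `≥ δ`, where `2M‖m̂‖ ≤ 2M(R_m + dev) ≤ 2M(R_m/δ + 1) dev`); conclude with the abstract squeeze
`EABirthS0b.tendsto_lintegral_abs_integral_sub`. Reusable by the sibling crux `FluxClosure` (same frame, same functionals). -/
def Sig.stub_staticEntropyFunctionalsLLN : Prop :=
  InFrame Cge1

/-- **GE2 — the test-function transport identity (deterministic calculus on `[0,τ] × 𝕋³`; size S–M, provable now).**
For `φ` smooth on `[0,T) × 𝕋³`, `τ ∈ [0,T)`, a constant `h` and a constant vector `v`: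
`∫_{(0,τ]} ∫ (h ∂ₜφ + h v·∇φ) dx dt − ∫ h φ(τ,·) dx + ∫ h φ(0,·) dx = 0` — the entropy balance of a CONSTANT state
`(h = ρ̄ Z(s̄), flux h v)` tested against `φ` vanishes identically. Why true: `∫_{𝕋³} ∇(φ t) dx = 0`
(`Torus.integral_gradient_eq_zero` / `integral_partialDeriv_eq_zero_of_isContDiff`, slices are smooth), Fubini on
`(0,τ] × 𝕋³` (the integrand is continuous on the compact `[0,τ] × 𝕋³`), and the fundamental theorem of calculus in `t` for
`t ↦ φ t x` on `[0,τ] ⊂ [0,T)` (`timeDerivWithin (Ico 0 T) φ t x = derivWithin (φ · x) (Ico 0 T) t`). -/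
def Sig.stub_testTransportIdentity : Prop :=
  ∀ (T τ : ℝ), τ ∈ Ico 0 T → ∀ φ : ℝ → T3 → ℝ,
    Literature.Analysis.FunctionSpaces.Torus.IsSmoothSpaceTimeOn (Ico 0 T) φ →
    ∀ (h : ℝ) (v : V3),
      (∫ t in Ioc 0 τ, ∫ x, (h * Literature.Analysis.FunctionSpaces.Torus.timeDerivWithin (Ico 0 T) φ t x +
          h * inner ℝ v (Literature.Analysis.FunctionSpaces.Torus.gradient (φ t) x))) -
        (∫ x, h * φ τ x) + ∫ x, h * φ 0 x = 0

/- (r10: now the tree's `EABirthGE3.CdynAbs`, landed p162417; text kept for the record)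
**The two-sided dynamic conclusion `CdynAbs`: `E_{P_N}|A_N + B| → 0`** (`A_N → −B` in `L¹(P_N)`: the clamp-renormalised
entropy balance holds with EQUALITY in the limit — zero entropy production; implies `Cdyn`, `Cdef`, `Cconc`).
  def CdynAbs : Conclusion := fun σ η₁ a₀ θ₀ u₀ T ρ θ _u Φ ℓ τ a b φ =>
  Tendsto (fun N : ℕ => ∫⁻ z, ENNReal.ofReal |dynPart σ η₁ T ℓ Φ τ a b φ N z + initLimit σ η₁ ρ θ a b φ|
    ∂(localGibbsLaw σ a₀ u₀ θ₀ N (Φ N))) atTop (𝓝 0)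
-/

/-- **GE3 — the global-equilibrium entropy balance (assembly; size L, provable now — the S2b template).**
`GE1 → GE2 → InFrameConst CdynAbs`: at global equilibrium `A_N → −B` in `L¹(P_N)`. Why true: write (a.s., `EABirthS2b.gflow`)
`A_N = ∫_{(0,τ]} g_N(t) dt − k_N` with `g_N(t,z) = ∫ statBulk(ψ₁,ψ₂,t)(Φ_t z, x) dx`, `k_N(z) = ∫ statBdry(φ_τ)(Φ_τ z, x) dx`
(`EABirthS1a.dynPart_eq_clamp`, time-clamped test data `ψ₁ = ∂ₜφ`, `ψ₂ = ∇φ`); for constant profiles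
`(P_N).map Φ_t = P_N` (`map_flow_localGibbsLaw_const`), so `E|F(Φ_t z) − c| = E|F(z) − c| = E|F(Φ_0 z) − c|` for every
measurable static functional `F` (`lintegral_map`; `Φ_0 = id` a.s.), and GE1 at the constant Euler data gives, for every
`t`, `E|g_N(t) − ḡ(t)| → 0`, `ḡ(t) = ∫ (h̄ ψ₁(t,x) + h̄ ⟪cv, ψ₂(t,x)⟫) dx`, `h̄ = cρ Z(s_cut(cρ, cϑ))`, and `E|k_N − h̄∫φ_τ| → 0`;
dominated convergence in `t` exactly as `EABirthS2bA.tendsto_conc_integral` (dominator from `exists_abs_statBulk_le` and the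
uniform kinetic moment `exists_lintegral_meanKinetic_le`) gives `E|∫(g_N − ḡ) dt| → 0`; finally
`∫_{(0,τ]} ḡ dt − h̄ ∫φ_τ + B = 0` is GE2 with `h = h̄`, `v = cv` (`B = initLimit = h̄ ∫ φ_0`). -/
def Sig.stub_globalEquilibriumEntropyBalance : Prop :=
  Sig.stub_staticEntropyFunctionalsLLN → Sig.stub_testTransportIdentity → InFrameConst CdynAbs

/-- **Conclusion `Cmacro` (r11): positive-time concentration of the MACROSCOPIC empirical density and momentum fields** (tested against a
fixed continuous `χ`, as in `TendstoHydroFieldsAt`) about their means, in `L¹(P_N)`, at every `t ∈ [0,T)` — the fluctuation half of the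
conjunct's conclusion at positive times (the conjunct asserts convergence in probability to the Euler solution, which implies this). -/
def Cmacro : Conclusion := fun σ _η₁ a₀ θ₀ u₀ T _ρ _θ _u Φ _ℓ _τ _a _b _φ =>
  ∀ t ∈ Ico 0 T, ∀ χ : T3 → ℝ, Continuous χ →
    Tendsto (fun N : ℕ => ∫⁻ z, ENNReal.ofReal
        |empiricalDensityField ((Φ N).flow t z) χ -
          ∫ z', empiricalDensityField ((Φ N).flow t z') χ ∂(localGibbsLaw σ a₀ u₀ θ₀ N (Φ N))|
      ∂(localGibbsLaw σ a₀ u₀ θ₀ N (Φ N))) atTop (𝓝 0) ∧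
    ∀ k : Fin 3, Tendsto (fun N : ℕ => ∫⁻ z, ENNReal.ofReal
        |empiricalMomentumField ((Φ N).flow t z) χ k -
          ∫ z', empiricalMomentumField ((Φ N).flow t z') χ k ∂(localGibbsLaw σ a₀ u₀ θ₀ N (Φ N))|
      ∂(localGibbsLaw σ a₀ u₀ θ₀ N (Φ N))) atTop (𝓝 0)

/-- **S2a' is at least conjunct-fluctuation-strength (r11; necessity-type bookkeeping, size S–M, provable now).**
`S2a' → InFrame Cmacro`: the in-band positive-time box concentration implies positive-time concentration of the MACROSCOPIC empirical
density and momentum fields about their means (take `G = r`, resp. `G = m_k`, `ψ = χ` in S2a'; the box functional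
`∫ ρ̂_t(z,x) χ(x) dx = (N+1)⁻¹ Σᵢ (K_ℓ ⋆ χ)(qᵢ(t))` differs from `empiricalDensityField (Φ_t z) χ = (N+1)⁻¹ Σᵢ χ(qᵢ(t))` by at most the
modulus of continuity of `χ` at scale `ℓ_N` — the box `{∀ i, ‖yᵢ − xᵢ‖ < ℓ/2}` is the sup-metric ball — deterministically, and for the
momentum by that modulus times `(N+1)⁻¹ Σ‖vᵢ‖`, whose mean is bounded by the conserved kinetic energy). So no line should expect S2a' to
be easier than the law-of-large-numbers half of the hydrodynamic limit at positive times. -/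
def Sig.stub_macroConcentration_of_PTBCInBand : Prop :=
  Sig.stub_positiveTimeBoxConcentrationInBand → InFrame Cmacro

/-! ### r13 — the FINE-SCALE bridge (lead c2): the crux follows from the box-scale hydrodynamic limit in `L¹` -/

/- (r14: now the tree's `EABirthFS3.Cptlgfs` / `EABirthFS3.Cge1t`, landed p165570 / FS1 p164907; text kept for the record)
**Conclusion `Cptlgfs` — the POSITIVE-TIME fine-scale law of large numbers** (the box-scale hydrodynamic limit in
`L¹(P_N ⊗ dx)` on `[0,T)`): at every `t ∈ [0,T)` the box fields `(ρ̂, m̂, Ê)(t)` converge to the Euler state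
`(ρ, ρu, E(ρ,u,θ))(t,·)` — verbatim the conclusion of the landed `LocalGibbsFineScale` (K0, `t = 0`) at time `t`. OPEN (it is
the route's bet in its strongest form, stronger than the conjunct `HydrodynamicLimit`); used below ONLY as the antecedent of
implications (never a stub of the composition: that would make the route circular).
  def Cptlgfs : Conclusion := fun σ _η₁ a₀ θ₀ u₀ T ρ θ u Φ ℓ _τ _a _b _φ =>
  ∀ t ∈ Ico 0 T, Tendsto (fun N : ℕ => ∫⁻ z, ENNReal.ofReal (∫ x,
      (|boxDensity σ ℓ Φ N t z x - ρ t x| + ‖boxMomentum σ ℓ Φ N t z x - ρ t x • u t x‖ +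
        |boxEnergy σ ℓ Φ N t z x - totalEnergyDensity (ρ t x) (u t x) (θ t x)|))
    ∂(localGibbsLaw σ a₀ u₀ θ₀ N (Φ N))) atTop (𝓝 0)

**Conclusion `Cge1t` — GE1 at time `t` under the time-`t` fine-scale LLN**: for every `t ∈ [0,T)`, IF the box fields at
time `t` converge in `L¹(P_N ⊗ dx)` to the Euler state at `t`, THEN the two entropy functionals at time `t` converge:
`E|∫ ρ̂_t Z(ŝ_t) ψ − ∫ ρ_t Z(s_t) ψ| → 0`, `E|∫ Z(ŝ_t) m̂_t·Ψ − ∫ Z(s_t) ρ_t u_t·Ψ| → 0` (`s_t = s_cut(ρ(t,x), θ(t,x))`).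
  def Cge1t : Conclusion := fun σ η₁ a₀ θ₀ u₀ T ρ θ u Φ ℓ _τ a b _φ =>
  ∀ t ∈ Ico 0 T,
    Tendsto (fun N : ℕ => ∫⁻ z, ENNReal.ofReal (∫ x,
        (|boxDensity σ ℓ Φ N t z x - ρ t x| + ‖boxMomentum σ ℓ Φ N t z x - ρ t x • u t x‖ +
          |boxEnergy σ ℓ Φ N t z x - totalEnergyDensity (ρ t x) (u t x) (θ t x)|))
      ∂(localGibbsLaw σ a₀ u₀ θ₀ N (Φ N))) atTop (𝓝 0) →
    (∀ ψ : T3 → ℝ, Continuous ψ →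
      Tendsto (fun N : ℕ => ∫⁻ z, ENNReal.ofReal
          |(∫ x, boxDensity σ ℓ Φ N t z x * boxClampedEntropy σ η₁ ℓ Φ a b N t z x * ψ x) -
            ∫ x, ρ t x * clamp a b (cutEntropy σ η₁ (ρ t x) (θ t x)) * ψ x|
        ∂(localGibbsLaw σ a₀ u₀ θ₀ N (Φ N))) atTop (𝓝 0)) ∧
    (∀ Ψ : T3 → V3, Continuous Ψ →
      Tendsto (fun N : ℕ => ∫⁻ z, ENNReal.ofReal
          |(∫ x, boxClampedEntropy σ η₁ ℓ Φ a b N t z x * inner ℝ (boxMomentum σ ℓ Φ N t z x) (Ψ x)) -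
            ∫ x, clamp a b (cutEntropy σ η₁ (ρ t x) (θ t x)) * inner ℝ (ρ t x • u t x) (Ψ x)|
        ∂(localGibbsLaw σ a₀ u₀ θ₀ N (Φ N))) atTop (𝓝 0))
-/

/-- **FS1 — GE1 at time `t` from the time-`t` fine-scale LLN (size M, provable now: the landed GE1 proof `EABirthGE1` with `0 ↦ t`
and the LLN taken as hypothesis instead of from `LGFS.localGibbsFineScale_of_pos`).** `InFrame Cge1t`. -/
def Sig.stub_fsEntropyFunctionalsLLN : Prop :=
  InFrame Cge1t

/-- **FS2a — weak renormalised entropy CONSERVATION for classical hard-sphere-Euler solutions, smooth renormalisation (pure PDE;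
size M–L, provable now).** For `σ > 0`, `f_ex` smooth on `(0, η₀)`, a classical solution `(ρ,u,θ)` on `[0,T) × 𝕋³` staying in the band
`ρσ³ < η₀`, every smooth `Z : ℝ → ℝ`, `τ ∈ [0,T)` and `φ` smooth on `[0,T) × 𝕋³`: with `s = 3/2 log θ − log ρ − f_ex(ρσ³)`,
`∫_{(0,τ]} ∫ (ρ Z(s) ∂ₜφ + Z(s) ρu·∇φ) dx dt − ∫ ρ Z(s) φ|_τ + ∫ ρ Z(s) φ|_0 = 0`. Why true: the pointwise entropy balance
`∂ₜ(ρs) + div(ρsu) = 0` (`JaynesSqueezeClosure.entropy_balance`) and mass conservation give `∂ₜ(ρZ(s)) + div(ρZ(s)u) = 0`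
(`ρZ(s) = G(ρ, ρs)`, chain rule); test against `φ`: `d/dt ∫ ρZ(s)φ dx = ∫ (ρZ(s)∂ₜφ + ρZ(s)u·∇φ) dx` (differentiation under `∫`,
`IsSmoothSpaceTimeOn.hasDerivWithinAt_integral`; `∫ div(V) φ = −∫ V·∇φ` on `𝕋³`), then the fundamental theorem of calculus on `[0,τ]`
(as `JaynesSqueezeClosure.integral_entropy_eq`, `EABirthGE2.integral_Ioc_integral_timeDerivWithin_eq`). -/
def Sig.stub_smoothRenormalizedEntropyConservation : Prop :=
  ∀ (σ η₀ : ℝ), 0 < σ → 0 < η₀ → ContDiffOn ℝ ∞ hsExcessFreeEnergy (Ioo 0 η₀) →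
    ∀ (T : ℝ) (ρ θ : ℝ → T3 → ℝ) (u : ℝ → T3 → V3), IsHardSphereEulerSolution σ T ρ u θ →
      (∀ t ∈ Ico 0 T, ∀ x, ρ t x * σ ^ 3 < η₀) →
      ∀ Z : ℝ → ℝ, ContDiff ℝ ∞ Z →
      ∀ τ ∈ Ico 0 T, ∀ φ : ℝ → T3 → ℝ, Literature.Analysis.FunctionSpaces.Torus.IsSmoothSpaceTimeOn (Ico 0 T) φ →
        (∫ t in Ioc 0 τ, ∫ x,
            (ρ t x * Z (3 / 2 * Real.log (θ t x) - Real.log (ρ t x) - hsExcessFreeEnergy (ρ t x * σ ^ 3)) *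
                Literature.Analysis.FunctionSpaces.Torus.timeDerivWithin (Ico 0 T) φ t x +
              Z (3 / 2 * Real.log (θ t x) - Real.log (ρ t x) - hsExcessFreeEnergy (ρ t x * σ ^ 3)) *
                inner ℝ (ρ t x • u t x) (Literature.Analysis.FunctionSpaces.Torus.gradient (φ t) x))) -
          (∫ x, ρ τ x * Z (3 / 2 * Real.log (θ τ x) - Real.log (ρ τ x) - hsExcessFreeEnergy (ρ τ x * σ ^ 3)) * φ τ x) +
          ∫ x, ρ 0 x * Z (3 / 2 * Real.log (θ 0 x) - Real.log (ρ 0 x) - hsExcessFreeEnergy (ρ 0 x * σ ^ 3)) * φ 0 x = 0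

/-- **FS2b — the same for the Lipschitz clamp `Z_{a,b}` (size M, provable now: from FS2a by mollification).** `FS2a →` the identity with
`Z = clamp a b`, `a < b`. Why true: mollify the `1`-Lipschitz clamp, `Z_ε = φ_ε.normed ⋆ clamp a b` (`ContDiffBump`; smooth:
`HasCompactSupport.contDiff_convolution_left`; `|Z_ε − Z_{a,b}| ≤ ε`: `ContDiffBump.dist_normed_convolution_le`), apply FS2a to `Z_ε` and
let `ε → 0` in the four integrals (integrands converge uniformly on the compact `[0,τ] × 𝕋³`; cf. `Literature.Analysis.Calculus.PeriodicMollifier`). -/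
def Sig.stub_clampedRenormalizedEntropyConservation : Prop :=
  Sig.stub_smoothRenormalizedEntropyConservation →
  ∀ (σ η₀ : ℝ), 0 < σ → 0 < η₀ → ContDiffOn ℝ ∞ hsExcessFreeEnergy (Ioo 0 η₀) →
    ∀ (T : ℝ) (ρ θ : ℝ → T3 → ℝ) (u : ℝ → T3 → V3), IsHardSphereEulerSolution σ T ρ u θ →
      (∀ t ∈ Ico 0 T, ∀ x, ρ t x * σ ^ 3 < η₀) →
      ∀ a b : ℝ, a < b →
      ∀ τ ∈ Ico 0 T, ∀ φ : ℝ → T3 → ℝ, Literature.Analysis.FunctionSpaces.Torus.IsSmoothSpaceTimeOn (Ico 0 T) φ →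
        (∫ t in Ioc 0 τ, ∫ x,
            (ρ t x * clamp a b (3 / 2 * Real.log (θ t x) - Real.log (ρ t x) - hsExcessFreeEnergy (ρ t x * σ ^ 3)) *
                Literature.Analysis.FunctionSpaces.Torus.timeDerivWithin (Ico 0 T) φ t x +
              clamp a b (3 / 2 * Real.log (θ t x) - Real.log (ρ t x) - hsExcessFreeEnergy (ρ t x * σ ^ 3)) *
                inner ℝ (ρ t x • u t x) (Literature.Analysis.FunctionSpaces.Torus.gradient (φ t) x))) -
          (∫ x, ρ τ x * clamp a b (3 / 2 * Real.log (θ τ x) - Real.log (ρ τ x) - hsExcessFreeEnergy (ρ τ x * σ ^ 3)) *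
              φ τ x) +
          ∫ x, ρ 0 x * clamp a b (3 / 2 * Real.log (θ 0 x) - Real.log (ρ 0 x) - hsExcessFreeEnergy (ρ 0 x * σ ^ 3)) *
              φ 0 x = 0

/-- **FS3 — the crux's two-sided dynamic conclusion from the fine-scale LLN (assembly; size L, provable now — the GE3 template with
flow-invariance replaced by the time-`t` LLN hypothesis and GE2 by FS2b).** `FS1 → FS2b-conclusion → (InFrame Cptlgfs → InFrame CdynAbs)`:
under the box-scale hydrodynamic limit in `L¹` the clamp-renormalised entropy balance of the box fields converges to that of the
classical solution, which VANISHES (isentropy): `A_N → −B` in `L¹(P_N)`. On the band `ρσ³ ≤ η₁/2 < η₁` the cut entropy IS the entropy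
(`cutEntropy σ η₁ r ϑ = 3/2 log ϑ − log r − f_ex(rσ³)` for `rσ³ ≤ η₁`), and `η₁ < η_c ≤ η₀` keeps `f_ex` analytic there. -/
def Sig.stub_cruxOfFineScaleLLN : Prop :=
  Sig.stub_fsEntropyFunctionalsLLN →
  (∀ (σ η₀ : ℝ), 0 < σ → 0 < η₀ → ContDiffOn ℝ ∞ hsExcessFreeEnergy (Ioo 0 η₀) →
    ∀ (T : ℝ) (ρ θ : ℝ → T3 → ℝ) (u : ℝ → T3 → V3), IsHardSphereEulerSolution σ T ρ u θ →
      (∀ t ∈ Ico 0 T, ∀ x, ρ t x * σ ^ 3 < η₀) →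
      ∀ a b : ℝ, a < b →
      ∀ τ ∈ Ico 0 T, ∀ φ : ℝ → T3 → ℝ, Literature.Analysis.FunctionSpaces.Torus.IsSmoothSpaceTimeOn (Ico 0 T) φ →
        (∫ t in Ioc 0 τ, ∫ x,
            (ρ t x * clamp a b (3 / 2 * Real.log (θ t x) - Real.log (ρ t x) - hsExcessFreeEnergy (ρ t x * σ ^ 3)) *
                Literature.Analysis.FunctionSpaces.Torus.timeDerivWithin (Ico 0 T) φ t x +
              clamp a b (3 / 2 * Real.log (θ t x) - Real.log (ρ t x) - hsExcessFreeEnergy (ρ t x * σ ^ 3)) *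
                inner ℝ (ρ t x • u t x) (Literature.Analysis.FunctionSpaces.Torus.gradient (φ t) x))) -
          (∫ x, ρ τ x * clamp a b (3 / 2 * Real.log (θ τ x) - Real.log (ρ τ x) - hsExcessFreeEnergy (ρ τ x * σ ^ 3)) *
              φ τ x) +
          ∫ x, ρ 0 x * clamp a b (3 / 2 * Real.log (θ 0 x) - Real.log (ρ 0 x) - hsExcessFreeEnergy (ρ 0 x * σ ^ 3)) *
              φ 0 x = 0) →
  InFrame Cptlgfs → InFrame CdynAbs

/-! ## §2 Stubs (registered; `sorry` only inside the open ones) — S0a, S0b, S1a, S2b, sandwich, S2b', composition, GCH-necessity LANDED; OPEN: S1b (heart), S2a' -/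

/-- **S0a — LANDED** (p148838, `Theorems/BoxDissipativeWeakStrongEntropyAdmissibilityStubEntropyModulus.lean`):
uniform modulus of continuity of the clamped cut entropy near a compact set of physical band states. -/
theorem stub_entropyModulus : Sig.stub_entropyModulus :=
  Summit.AtomisticToContinuum.HydrodynamicLimit.Theorems.EABirthS0a.stub_entropyModulus

/-- **S0b — LANDED** (p149919, `Theorems/BoxDissipativeWeakStrongEntropyAdmissibilityStubInitialEntropyLLN.lean`):
the initial entropy LLN `B_N → B` in `L¹(P_N)` from the modulus S0a and the landed fine-scale LLN. -/
theorem stub_initialEntropyLLN_of_modulus : Sig.stub_initialEntropyLLN_of_modulus :=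
  Summit.AtomisticToContinuum.HydrodynamicLimit.Theorems.EABirthS0b.stub_initialEntropyLLN_of_modulus

/-- **S1a — LANDED** (p150196, `Theorems/BoxDissipativeWeakStrongEntropyAdmissibilityStubDynPartIntegrable.lean`):
`A_N ∈ L¹(P_N)` for every `N`. -/
theorem stub_dynPartIntegrable : Sig.stub_dynPartIntegrable :=
  Summit.AtomisticToContinuum.HydrodynamicLimit.Theorems.EABirthS1a.stub_dynPartIntegrable

/-- **S1b (open; the heart).** Annealed local entropy deficit: eventually `E[A_N] + B ≤ ε`. -/
theorem stub_meanEntropyDeficit : Sig.stub_meanEntropyDeficit := by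
  sorry

/-- **S2a' (open; positive-time weak local equilibrium at the level of FLUCTUATIONS, in the band; r6 replaces S2a).**
Positive-time box-scale self-averaging of deterministic hard spheres under local Gibbs data, in the crux's frame. -/
theorem stub_positiveTimeBoxConcentrationInBand : Sig.stub_positiveTimeBoxConcentrationInBand := by
  sorry

/-- **S2b' — LANDED** (p157094, `Theorems/BoxDissipativeWeakStrongEntropyAdmissibilityStubConcentrationOfPTBCInBand.lean`,
namespace `EABirthS2bG`; r6 registered, r8 imported): `S2a' → S2`. -/
theorem stub_entropyBalanceConcentration_of_PTBCInBand : Sig.stub_entropyBalanceConcentration_of_PTBCInBand :=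
  Summit.AtomisticToContinuum.HydrodynamicLimit.Theorems.EABirthS2bG.stub_entropyBalanceConcentration_of_PTBCInBand

/-- **S2b — LANDED** (p153346, `Theorems/BoxDissipativeWeakStrongEntropyAdmissibilityStubConcentrationOfPTBC.lean`; helper part A
p152716 `…StubConcentrationOfPTBCA.lean`): S2 from S2a — linear-growth integrands, Fubini in `(t, z)`, dominated convergence in `t`.
(Kept for the record; since r6 the composition runs through S2b' ∘ S2a'.) -/
theorem stub_entropyBalanceConcentration_of_PTBC : Sig.stub_entropyBalanceConcentration_of_PTBC :=
  Summit.AtomisticToContinuum.HydrodynamicLimit.Theorems.EABirthS2b.stub_entropyBalanceConcentration_of_PTBC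

/-- **Sandwich stub — LANDED** (p156387, `Theorems/BoxDissipativeWeakStrongEntropyAdmissibilityDynamicCore.lean`, namespace
`EABirthCore`; r4 registered, r5 imported): `(crux ↔ DynCore) ∧ (DynCore → S1b) ∧ (S1b → S2 → DynCore)`. -/
theorem stub_dynamicCoreSandwich : Sig.stub_dynamicCoreSandwich :=
  Summit.AtomisticToContinuum.HydrodynamicLimit.Theorems.EABirthCore.stub_dynamicCoreSandwich

/-- **Composition stub — LANDED** (p157831, `Theorems/BoxDissipativeWeakStrongEntropyAdmissibilityOfOpenStubs.lean`, namespace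
`EABirthAssembly`; r6 registered, r8 imported): `S1b → S2a' → crux`, the line's composition in the tree. -/
theorem stub_cruxOfOpenStubs : Sig.stub_cruxOfOpenStubs :=
  Summit.AtomisticToContinuum.HydrodynamicLimit.Theorems.EABirthAssembly.stub_cruxOfOpenStubs

/-- **GCH-necessity stub — LANDED** (p158167, `Theorems/BoxDissipativeWeakStrongEntropyAdmissibilityGlobalClampedHTheorem.lean`,
namespace `EABirthGCH`; r7 registered, r8 imported): `(crux → GCH) ∧ (S1b → GCH)`. -/
theorem stub_globalClampedHTheoremNecessary : Sig.stub_globalClampedHTheoremNecessary :=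
  Summit.AtomisticToContinuum.HydrodynamicLimit.Theorems.EABirthGCH.stub_globalClampedHTheoremNecessary

/-- **GE1 — LANDED** (p161002, `Theorems/BoxDissipativeWeakStrongEntropyAdmissibilityStubStaticEntropyFunctionalsLLN.lean`, namespace
`EABirthGE1`; r9 registered, wave 1 of lead c2): static LLN at `t = 0` for the two entropy functionals, general profiles. -/
theorem stub_staticEntropyFunctionalsLLN : Sig.stub_staticEntropyFunctionalsLLN :=
  Summit.AtomisticToContinuum.HydrodynamicLimit.Theorems.EABirthGE1.stub_staticEntropyFunctionalsLLN

/-- **GE2 — LANDED** (p160969, `Theorems/BoxDissipativeWeakStrongEntropyAdmissibilityStubTestTransportIdentity.lean`, namespace `EABirthGE2`;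
r9 registered, wave 1 of lead c2): the test-function transport identity on `[0,τ] × 𝕋³`. -/
theorem stub_testTransportIdentity : Sig.stub_testTransportIdentity :=
  Summit.AtomisticToContinuum.HydrodynamicLimit.Theorems.EABirthGE2.stub_testTransportIdentity

/-- **GE3 — LANDED** (p162417, `Theorems/BoxDissipativeWeakStrongEntropyAdmissibilityStubGlobalEquilibriumEntropyBalance.lean` + helpers p161932
`…Helpers.lean` with the registered helper stub `stub_globalEquilibriumEntropyBalanceA`, namespace `EABirthGE3`; r9 registered, wave 1 of
lead c2): the global-equilibrium entropy balance `A_N → −B` in `L¹(P_N)` from GE1, GE2. -/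
theorem stub_globalEquilibriumEntropyBalance : Sig.stub_globalEquilibriumEntropyBalance :=
  Summit.AtomisticToContinuum.HydrodynamicLimit.Theorems.EABirthGE3.stub_globalEquilibriumEntropyBalance

/-- Signature alias of the registered helper stub GE3A (worker GE3's helpers file, landed p161932). -/
def Sig.stub_globalEquilibriumEntropyBalanceA : Prop :=
  Summit.AtomisticToContinuum.HydrodynamicLimit.Theorems.EABirthGE3.Sig.stub_globalEquilibriumEntropyBalanceA

/-- **GE3A — LANDED** (p161932, `…StubGlobalEquilibriumEntropyBalanceHelpers.lean`): DCT-in-`t` to an explicit limit, invariance transfer,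
bulk/boundary convergence at global equilibrium. -/
theorem stub_globalEquilibriumEntropyBalanceA : Sig.stub_globalEquilibriumEntropyBalanceA :=
  Summit.AtomisticToContinuum.HydrodynamicLimit.Theorems.EABirthGE3.stub_globalEquilibriumEntropyBalanceA

/-- **GE conclusions (r10; bookkeeping over GE1–GE3 + S0 + S1a, size S, provable now — lands the §3 sub-frame theorems).**
On the global-equilibrium sub-frame: S1b (`Cdef`), S2 (`Cconc`), DynCore (`Cdyn`) and the crux's own conclusion (`Ccrux`) hold; the
sub-frame is an instance of the frame (`InFrame C → InFrameConst C`), in particular of the crux. -/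
def Sig.stub_globalEquilibriumConclusions : Prop :=
  InFrameConst Cdef ∧ InFrameConst Cconc ∧ InFrameConst Cdyn ∧ InFrameConst Ccrux ∧
    (BoxDissipativeWeakStrong.EntropyAdmissibility → InFrameConst Ccrux) ∧ (∀ C : Conclusion, InFrame C → InFrameConst C)

/-- **S2a' ⇒ macroscopic positive-time concentration — LANDED** (p164016,
`Theorems/BoxDissipativeWeakStrongEntropyAdmissibilityMacroConcentrationOfPTBCInBand.lean`, namespace `EABirthMacro`; r11 registered, wave 2 of
lead c2). -/
theorem stub_macroConcentration_of_PTBCInBand : Sig.stub_macroConcentration_of_PTBCInBand :=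
  Summit.AtomisticToContinuum.HydrodynamicLimit.Theorems.EABirthMacro.stub_macroConcentration_of_PTBCInBand

/-- **FS1 — LANDED** (p164907, `Theorems/BoxDissipativeWeakStrongEntropyAdmissibilityStubFsEntropyFunctionalsLLN.lean`, `EABirthFS1`; r13, wave 3). -/
theorem stub_fsEntropyFunctionalsLLN : Sig.stub_fsEntropyFunctionalsLLN :=
  Summit.AtomisticToContinuum.HydrodynamicLimit.Theorems.EABirthFS1.stub_fsEntropyFunctionalsLLN

/-- **FS2a — LANDED** (p165136, `Theorems/BoxDissipativeWeakStrongEntropyAdmissibilityStubSmoothRenormalizedEntropyConservation.lean`, `EABirthFS2a`;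
r13, wave 3): weak renormalised entropy conservation of classical hs-Euler solutions, smooth `Z`. -/
theorem stub_smoothRenormalizedEntropyConservation : Sig.stub_smoothRenormalizedEntropyConservation :=
  Summit.AtomisticToContinuum.HydrodynamicLimit.Theorems.EABirthFS2a.stub_smoothRenormalizedEntropyConservation

/-- **FS2b — LANDED** (p165372, `Theorems/BoxDissipativeWeakStrongEntropyAdmissibilityStubClampedRenormalizedEntropyConservation.lean`, `EABirthFS2b`;
r13, wave 3): the same for the Lipschitz clamp, by mollification. -/
theorem stub_clampedRenormalizedEntropyConservation : Sig.stub_clampedRenormalizedEntropyConservation :=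
  Summit.AtomisticToContinuum.HydrodynamicLimit.Theorems.EABirthFS2b.stub_clampedRenormalizedEntropyConservation

/-- **FS3 — LANDED** (p165570, `Theorems/BoxDissipativeWeakStrongEntropyAdmissibilityStubCruxOfFineScaleLLN.lean`, `EABirthFS3`; r13, wave 3):
the assembly `FS1 → FS2b-conclusion → (InFrame Cptlgfs → InFrame CdynAbs)`. -/
theorem stub_cruxOfFineScaleLLN : Sig.stub_cruxOfFineScaleLLN :=
  Summit.AtomisticToContinuum.HydrodynamicLimit.Theorems.EABirthFS3.stub_cruxOfFineScaleLLN

/-- **Fine-scale bridge conclusions (r14; bookkeeping, size XS, provable now — lands §3's bridge theorems).** The crux, its open heart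
S1b and its two-sided dynamic conclusion follow from the box-scale hydrodynamic limit in `L¹` (`InFrame Cptlgfs`). -/
def Sig.stub_fineScaleBridge : Prop :=
  (InFrame Cptlgfs → InFrame CdynAbs) ∧ (InFrame Cptlgfs → BoxDissipativeWeakStrong.EntropyAdmissibility) ∧
    (InFrame Cptlgfs → InFrame Cdef)

/-! ## §3 Derived former stubs (sorry-free glue) -/

/-- **S2 (derived; since reshape r6 from S2b' applied to S2a')**: no anomalous entropy fluctuations. -/
theorem entropyBalanceConcentration : Sig.stub_entropyBalanceConcentration :=
  stub_entropyBalanceConcentration_of_PTBCInBand stub_positiveTimeBoxConcentrationInBand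

/-- **S0 (derived)**: the initial entropy LLN, from S0b applied to S0a. -/
theorem initialEntropyLLN : Sig.stub_initialEntropyLLN :=
  stub_initialEntropyLLN_of_modulus stub_entropyModulus

/-- **S1 from S1a and S1b** (pure quantifier bookkeeping: common band threshold `min ηa ηb`, common density
threshold `min σa σb`). -/
theorem meanEntropyInequality_of (ha : Sig.stub_dynPartIntegrable) (hb : Sig.stub_meanEntropyDeficit) :
    Sig.stub_meanEntropyInequality := by
  intro hEos
  obtain ⟨ηa, hηa, Ha⟩ := ha hEos
  obtain ⟨ηb, hηb, Hb⟩ := hb hEos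
  refine ⟨min ηa ηb, lt_min hηa hηb, ?_⟩
  intro η₁ hη₁ hη₁c a₀ θ₀ u₀ hac hθc huc ha0 hθ0
  obtain ⟨σa, hσa, Ga⟩ := Ha η₁ hη₁ (lt_of_lt_of_le hη₁c (min_le_left _ _)) a₀ θ₀ u₀ hac hθc huc ha0 hθ0
  obtain ⟨σb, hσb, Gb⟩ := Hb η₁ hη₁ (lt_of_lt_of_le hη₁c (min_le_right _ _)) a₀ θ₀ u₀ hac hθc huc ha0 hθ0
  refine ⟨min σa σb, lt_min hσa hσb, ?_⟩
  intro σ hσ hσlt T ρ θ u hsol hguard Φ hLLN ℓ hℓ hℓ0 hℓ3 τ hτ a b hab φ hφ hφ0 ε hε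
  have Fa := Ga σ hσ (lt_of_lt_of_le hσlt (min_le_left _ _)) T ρ θ u hsol hguard Φ hLLN ℓ hℓ hℓ0 hℓ3
    τ hτ a b hab φ hφ hφ0
  have Fb := Gb σ hσ (lt_of_lt_of_le hσlt (min_le_right _ _)) T ρ θ u hsol hguard Φ hLLN ℓ hℓ hℓ0 hℓ3
    τ hτ a b hab φ hφ hφ0 ε hε
  filter_upwards [Fb] with N hN
  exact ⟨Fa N, hN⟩

/-- **S1 (derived)**: the annealed local entropy inequality with integrability. -/
theorem meanEntropyInequality : Sig.stub_meanEntropyInequality :=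
  meanEntropyInequality_of stub_dynPartIntegrable stub_meanEntropyDeficit

/-- **S1b is NECESSARY for the crux** (LANDED p153795,
`Theorems/BoxDissipativeWeakStrongEntropyAdmissibilityMeanEntropyDeficitNecessary.lean`): the crux decl implies the
open heart `Sig.stub_meanEntropyDeficit`, given the landed S0 and S1a (`E[A]+B ≤ E[(A+B_N)⁺] + E|B_N−B|`). So the
crux is EQUIVALENT to S1b modulo landed theorems and the fluctuation stub S2a: the reshape loses nothing on the S1 side. -/
theorem meanEntropyDeficit_necessary :
    BoxDissipativeWeakStrong.EntropyAdmissibility → Sig.stub_meanEntropyDeficit :=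
  Summit.AtomisticToContinuum.HydrodynamicLimit.Theorems.EABirthS1bNec.stub_meanEntropyDeficitNecessary

/-- **The crux is its dynamic core** (from the sandwich stub): `EntropyAdmissibility ↔ DynCore`. -/
theorem entropyAdmissibility_iff_dynamicCore :
    BoxDissipativeWeakStrong.EntropyAdmissibility ↔ Sig.stub_dynamicCore :=
  stub_dynamicCoreSandwich.1

/-- **The open content of the line is exactly DynCore**: it follows from the two open stubs S1b, S2a' (through S2b')
and gives back S1b. -/
theorem dynamicCore_of_open_stubs (h₁ : Sig.stub_meanEntropyDeficit) (h₂ : Sig.stub_positiveTimeBoxConcentrationInBand) :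
    Sig.stub_dynamicCore :=
  stub_dynamicCoreSandwich.2.2 h₁ (stub_entropyBalanceConcentration_of_PTBCInBand h₂)

/-- **GCH (derived; open through S1b)**: the global clamped H-theorem in mean — what any proof of the heart must in
particular deliver, and what a disproof of the crux may target. -/
theorem globalClampedHTheorem : Sig.globalClampedHTheorem :=
  stub_globalClampedHTheoremNecessary.2 stub_meanEntropyDeficit

/-! ### r9 — the global-equilibrium sub-frame: bookkeeping and derived conclusions (sorry-free glue over GE1–GE3) -/

/-- **The global-equilibrium sub-frame IS the crux's frame specialised**: `InFrame C → InFrameConst C` (instantiate the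
profiles and the Euler state at constants; `continuous_const`). -/
theorem InFrameConst.of_inFrame {C : Conclusion} (h : InFrame C) : InFrameConst C := by
  intro hEos
  obtain ⟨ηc, hηc, H⟩ := h hEos
  refine ⟨ηc, hηc, fun η₁ hη₁ hη₁c ca cθ cu hca hcθ => ?_⟩
  obtain ⟨σ₀, hσ₀, G⟩ := H η₁ hη₁ hη₁c (fun _ => ca) (fun _ => cθ) (fun _ => cu) continuous_const continuous_const
    continuous_const (fun _ => hca) (fun _ => hcθ)
  exact ⟨σ₀, hσ₀, fun σ hσ hσlt T cρ cϑ cv hsol hguard Φ hLLN ℓ hℓ hℓ0 hℓ3 τ hτ a b hab φ hφ hφ0 =>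
    G σ hσ hσlt T (fun _ _ => cρ) (fun _ _ => cϑ) (fun _ _ => cv) hsol hguard Φ hLLN ℓ hℓ hℓ0 hℓ3 τ hτ a b hab φ hφ hφ0⟩

/-- The crux implies its global-equilibrium instance (so every `InFrameConst` theorem below is a special case of what the
crux asserts, proved unconditionally). -/
theorem inFrameConst_crux_of_crux (h : BoxDissipativeWeakStrong.EntropyAdmissibility) : InFrameConst Ccrux :=
  InFrameConst.of_inFrame (entropyAdmissibility_iff_inFrame.1 h)

/-- The sub-frame holds for the trivial conclusion. -/
theorem InFrameConst.of_true : InFrameConst fun _ _ _ _ _ _ _ _ _ _ _ _ _ _ _ => True :=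
  fun _ => ⟨1, one_pos, fun _ _ _ _ _ _ _ _ => ⟨1, one_pos,
    fun _ _ _ _ _ _ _ _ _ _ _ _ _ _ _ _ _ _ _ _ _ _ _ => trivial⟩⟩

/-- **Sub-frame bookkeeping, once (arity 3)** — the `InFrame.mono₃` of `EABirthCore` on the global-equilibrium sub-frame. -/
theorem InFrameConst.mono₃ {C₁ C₂ C₃ C₄ : Conclusion} {ηs σs : ℝ} (hηs : 0 < ηs) (hσs : 0 < σs)
    (h : ∀ (σ η₁ ca cθ : ℝ) (cu : V3) (T cρ cϑ : ℝ) (cv : V3) (Φ : FlowFamily σ) (ℓ : ℕ → ℝ) (τ a b : ℝ)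
      (φ : ℝ → T3 → ℝ),
      0 < η₁ → η₁ < ηs → 0 < ca → 0 < cθ → 0 < σ → σ < σs →
      IsHardSphereEulerSolution σ T (fun _ _ => cρ) (fun _ _ => cv) (fun _ _ => cϑ) →
      (∀ t ∈ Ico 0 T, ∀ _x : T3, cρ * σ ^ 3 ≤ η₁ / 2) →
      TendstoHydroFieldsAt (fun N => localGibbsLaw σ (fun _ => ca) (fun _ => cu) (fun _ => cθ) N (Φ N)) Φ
        (fun _ _ => cρ) (fun _ _ => cv) (fun _ _ => cϑ) 0 →
      (∀ N, 0 < ℓ N ∧ ℓ N ≤ 1) → Tendsto ℓ atTop (𝓝 0) → Tendsto (fun N : ℕ => ℓ N ^ 3 * ((N : ℝ) + 1)) atTop atTop →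
      τ ∈ Ico 0 T → a < b → Literature.Analysis.FunctionSpaces.Torus.IsSmoothSpaceTimeOn (Ico 0 T) φ →
      (∀ t ∈ Icc 0 τ, ∀ x, 0 ≤ φ t x) →
      C₁ σ η₁ (fun _ => ca) (fun _ => cθ) (fun _ => cu) T (fun _ _ => cρ) (fun _ _ => cϑ) (fun _ _ => cv) Φ ℓ τ a b φ →
      C₂ σ η₁ (fun _ => ca) (fun _ => cθ) (fun _ => cu) T (fun _ _ => cρ) (fun _ _ => cϑ) (fun _ _ => cv) Φ ℓ τ a b φ →
      C₃ σ η₁ (fun _ => ca) (fun _ => cθ) (fun _ => cu) T (fun _ _ => cρ) (fun _ _ => cϑ) (fun _ _ => cv) Φ ℓ τ a b φ →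
      C₄ σ η₁ (fun _ => ca) (fun _ => cθ) (fun _ => cu) T (fun _ _ => cρ) (fun _ _ => cϑ) (fun _ _ => cv) Φ ℓ τ a b φ)
    (h₁ : InFrameConst C₁) (h₂ : InFrameConst C₂) (h₃ : InFrameConst C₃) : InFrameConst C₄ := by
  intro hEos
  obtain ⟨η1, hη1, H1⟩ := h₁ hEos
  obtain ⟨η2, hη2, H2⟩ := h₂ hEos
  obtain ⟨η3, hη3, H3⟩ := h₃ hEos
  refine ⟨min ηs (min η1 (min η2 η3)), lt_min hηs (lt_min hη1 (lt_min hη2 hη3)), ?_⟩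
  intro η₁ hη₁ hη₁c ca cθ cu hca hcθ
  have hs : η₁ < ηs := lt_of_lt_of_le hη₁c (min_le_left _ _)
  have e1 : η₁ < η1 := lt_of_lt_of_le hη₁c ((min_le_right _ _).trans (min_le_left _ _))
  have e2 : η₁ < η2 := lt_of_lt_of_le hη₁c ((min_le_right _ _).trans ((min_le_right _ _).trans (min_le_left _ _)))
  have e3 : η₁ < η3 := lt_of_lt_of_le hη₁c ((min_le_right _ _).trans ((min_le_right _ _).trans (min_le_right _ _)))
  obtain ⟨σ1, hσ1, G1⟩ := H1 η₁ hη₁ e1 ca cθ cu hca hcθ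
  obtain ⟨σ2, hσ2, G2⟩ := H2 η₁ hη₁ e2 ca cθ cu hca hcθ
  obtain ⟨σ3, hσ3, G3⟩ := H3 η₁ hη₁ e3 ca cθ cu hca hcθ
  refine ⟨min σs (min σ1 (min σ2 σ3)), lt_min hσs (lt_min hσ1 (lt_min hσ2 hσ3)), ?_⟩
  intro σ hσ hσlt T cρ cϑ cv hsol hguard Φ hLLN ℓ hℓ hℓ0 hℓ3 τ hτ a b hab φ hφ hφ0
  have ss : σ < σs := lt_of_lt_of_le hσlt (min_le_left _ _)
  have s1 : σ < σ1 := lt_of_lt_of_le hσlt ((min_le_right _ _).trans (min_le_left _ _))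
  have s2 : σ < σ2 := lt_of_lt_of_le hσlt ((min_le_right _ _).trans ((min_le_right _ _).trans (min_le_left _ _)))
  have s3 : σ < σ3 := lt_of_lt_of_le hσlt ((min_le_right _ _).trans ((min_le_right _ _).trans (min_le_right _ _)))
  exact h σ η₁ ca cθ cu T cρ cϑ cv Φ ℓ τ a b φ hη₁ hs hca hcθ hσ ss hsol hguard hLLN hℓ hℓ0 hℓ3 hτ hab hφ hφ0
    (G1 σ hσ s1 T cρ cϑ cv hsol hguard Φ hLLN ℓ hℓ hℓ0 hℓ3 τ hτ a b hab φ hφ hφ0)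
    (G2 σ hσ s2 T cρ cϑ cv hsol hguard Φ hLLN ℓ hℓ hℓ0 hℓ3 τ hτ a b hab φ hφ hφ0)
    (G3 σ hσ s3 T cρ cϑ cv hsol hguard Φ hLLN ℓ hℓ hℓ0 hℓ3 τ hτ a b hab φ hφ hφ0)

/-- **Sub-frame bookkeeping (arity 2).** -/
theorem InFrameConst.mono₂ {C₁ C₂ C₃ : Conclusion} {ηs σs : ℝ} (hηs : 0 < ηs) (hσs : 0 < σs)
    (h : ∀ (σ η₁ ca cθ : ℝ) (cu : V3) (T cρ cϑ : ℝ) (cv : V3) (Φ : FlowFamily σ) (ℓ : ℕ → ℝ) (τ a b : ℝ)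
      (φ : ℝ → T3 → ℝ),
      0 < η₁ → η₁ < ηs → 0 < ca → 0 < cθ → 0 < σ → σ < σs →
      IsHardSphereEulerSolution σ T (fun _ _ => cρ) (fun _ _ => cv) (fun _ _ => cϑ) →
      (∀ t ∈ Ico 0 T, ∀ _x : T3, cρ * σ ^ 3 ≤ η₁ / 2) →
      TendstoHydroFieldsAt (fun N => localGibbsLaw σ (fun _ => ca) (fun _ => cu) (fun _ => cθ) N (Φ N)) Φ
        (fun _ _ => cρ) (fun _ _ => cv) (fun _ _ => cϑ) 0 →
      (∀ N, 0 < ℓ N ∧ ℓ N ≤ 1) → Tendsto ℓ atTop (𝓝 0) → Tendsto (fun N : ℕ => ℓ N ^ 3 * ((N : ℝ) + 1)) atTop atTop →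
      τ ∈ Ico 0 T → a < b → Literature.Analysis.FunctionSpaces.Torus.IsSmoothSpaceTimeOn (Ico 0 T) φ →
      (∀ t ∈ Icc 0 τ, ∀ x, 0 ≤ φ t x) →
      C₁ σ η₁ (fun _ => ca) (fun _ => cθ) (fun _ => cu) T (fun _ _ => cρ) (fun _ _ => cϑ) (fun _ _ => cv) Φ ℓ τ a b φ →
      C₂ σ η₁ (fun _ => ca) (fun _ => cθ) (fun _ => cu) T (fun _ _ => cρ) (fun _ _ => cϑ) (fun _ _ => cv) Φ ℓ τ a b φ →
      C₃ σ η₁ (fun _ => ca) (fun _ => cθ) (fun _ => cu) T (fun _ _ => cρ) (fun _ _ => cϑ) (fun _ _ => cv) Φ ℓ τ a b φ)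
    (h₁ : InFrameConst C₁) (h₂ : InFrameConst C₂) : InFrameConst C₃ :=
  InFrameConst.mono₃ (C₃ := fun _ _ _ _ _ _ _ _ _ _ _ _ _ _ _ => True) hηs hσs
    (fun σ η₁ ca cθ cu T cρ cϑ cv Φ ℓ τ a b φ hη₁ hs hca hcθ hσ ss hsol hguard hLLN hℓ hℓ0 hℓ3 hτ hab hφ hφ0 c₁ c₂ _ =>
      h σ η₁ ca cθ cu T cρ cϑ cv Φ ℓ τ a b φ hη₁ hs hca hcθ hσ ss hsol hguard hLLN hℓ hℓ0 hℓ3 hτ hab hφ hφ0 c₁ c₂)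
    h₁ h₂ InFrameConst.of_true

/-- **GE (derived): at global equilibrium `A_N → −B` in `L¹(P_N)`** — from the stubs GE1, GE2, GE3. -/
theorem inFrameConst_dynAbs : InFrameConst CdynAbs :=
  stub_globalEquilibriumEntropyBalance stub_staticEntropyFunctionalsLLN stub_testTransportIdentity

/-- **S1b holds at global equilibrium** (the heart on the sub-frame): `E[A_N] + B ≤ E|A_N + B| → 0` (GE, S1a). -/
theorem inFrameConst_def : InFrameConst Cdef := by
  refine InFrameConst.mono₂ (C₁ := CdynAbs) (C₂ := Cint) one_pos one_half_pos ?_ inFrameConst_dynAbs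
    (InFrameConst.of_inFrame inFrame_int)
  intro σ η₁ ca cθ cu T cρ cϑ cv Φ ℓ τ a b φ _ _ hca hcθ _ ss _ _ _ _ _ _ _ _ _ _ c₁ c₂ ε hε
  haveI hP : ∀ N, IsProbabilityMeasure (localGibbsLaw σ (fun _ => ca) (fun _ => cu) (fun _ => cθ) N (Φ N)) :=
    fun N => isProbabilityMeasure_localGibbsLaw continuous_const continuous_const continuous_const (fun _ => hca)
      (fun _ => hcθ) ss.le N (Φ N)
  filter_upwards [ENNReal.tendsto_nhds_zero.1 c₁ (ENNReal.ofReal ε) (ENNReal.ofReal_pos.2 hε)] with N hN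
  have hint : Integrable (dynPart σ η₁ T ℓ Φ τ a b φ N)
      (localGibbsLaw σ (fun _ => ca) (fun _ => cu) (fun _ => cθ) N (Φ N)) := c₂ N
  have hAB := hint.add (integrable_const (initLimit σ η₁ (fun _ _ => cρ) (fun _ _ => cϑ) a b φ))
  calc (∫ z, dynPart σ η₁ T ℓ Φ τ a b φ N z ∂(localGibbsLaw σ (fun _ => ca) (fun _ => cu) (fun _ => cθ) N (Φ N))) +
        initLimit σ η₁ (fun _ _ => cρ) (fun _ _ => cϑ) a b φ
      = ∫ z, (dynPart σ η₁ T ℓ Φ τ a b φ N z + initLimit σ η₁ (fun _ _ => cρ) (fun _ _ => cϑ) a b φ)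
          ∂(localGibbsLaw σ (fun _ => ca) (fun _ => cu) (fun _ => cθ) N (Φ N)) := by
        rw [integral_add hint (integrable_const _), integral_const, probReal_univ, one_smul]
    _ ≤ ∫ z, |dynPart σ η₁ T ℓ Φ τ a b φ N z + initLimit σ η₁ (fun _ _ => cρ) (fun _ _ => cϑ) a b φ|
          ∂(localGibbsLaw σ (fun _ => ca) (fun _ => cu) (fun _ => cθ) N (Φ N)) :=
        integral_mono hAB hAB.abs fun z => le_abs_self _
    _ = (∫⁻ z, ENNReal.ofReal |dynPart σ η₁ T ℓ Φ τ a b φ N z + initLimit σ η₁ (fun _ _ => cρ) (fun _ _ => cϑ) a b φ|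
          ∂(localGibbsLaw σ (fun _ => ca) (fun _ => cu) (fun _ => cθ) N (Φ N))).toReal :=
        integral_eq_lintegral_of_nonneg_ae (Eventually.of_forall fun z => abs_nonneg _) hAB.abs.aestronglyMeasurable
    _ ≤ ε := by
        have h := ENNReal.toReal_mono ENNReal.ofReal_ne_top hN
        rwa [ENNReal.toReal_ofReal hε.le] at h

/-- **S2 holds at global equilibrium** (no anomalous entropy fluctuations on the sub-frame): `E|A_N − E A_N| ≤ 2 E|A_N + B| → 0`. -/
theorem inFrameConst_conc : InFrameConst Cconc := by
  refine InFrameConst.mono₂ (C₁ := CdynAbs) (C₂ := Cint) one_pos one_half_pos ?_ inFrameConst_dynAbs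
    (InFrameConst.of_inFrame inFrame_int)
  intro σ η₁ ca cθ cu T cρ cϑ cv Φ ℓ τ a b φ _ _ hca hcθ _ ss _ _ _ _ _ _ _ _ _ _ c₁ c₂
  haveI hP : ∀ N, IsProbabilityMeasure (localGibbsLaw σ (fun _ => ca) (fun _ => cu) (fun _ => cθ) N (Φ N)) :=
    fun N => isProbabilityMeasure_localGibbsLaw continuous_const continuous_const continuous_const (fun _ => hca)
      (fun _ => hcθ) ss.le N (Φ N)
  have h2 := ENNReal.Tendsto.const_mul c₁ (Or.inr ENNReal.ofNat_ne_top) (a := 2)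
  rw [mul_zero] at h2
  refine tendsto_of_tendsto_of_tendsto_of_le_of_le' tendsto_const_nhds h2 (Eventually.of_forall fun N => bot_le)
    (Eventually.of_forall fun N => ?_)
  have h := lintegral_ofReal_abs_sub_integral_le
    (localGibbsLaw σ (fun _ => ca) (fun _ => cu) (fun _ => cθ) N (Φ N)) (c₂ N)
    (-initLimit σ η₁ (fun _ _ => cρ) (fun _ _ => cϑ) a b φ)
  simpa only [sub_neg_eq_add] using h

/-- **DynCore holds at global equilibrium**: `E[(A_N + B)⁺] ≤ E|A_N + B| → 0`. -/
theorem inFrameConst_dyn : InFrameConst Cdyn := by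
  refine InFrameConst.mono₂ (C₁ := CdynAbs) (C₂ := fun _ _ _ _ _ _ _ _ _ _ _ _ _ _ _ => True) one_pos one_pos ?_
    inFrameConst_dynAbs InFrameConst.of_true
  intro σ η₁ ca cθ cu T cρ cϑ cv Φ ℓ τ a b φ _ _ _ _ _ _ _ _ _ _ _ _ _ _ _ _ c₁ _
  exact tendsto_of_tendsto_of_tendsto_of_le_of_le' tendsto_const_nhds c₁ (Eventually.of_forall fun N => bot_le)
    (Eventually.of_forall fun N => lintegral_mono fun z => ENNReal.ofReal_le_ofReal (le_abs_self _))

/-- **The crux's own conclusion holds at global equilibrium**: `E_{P_N}[(Q_N)⁺] → 0` on the sub-frame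
(`(A + B_N)⁺ ≤ (A + B)⁺ + |B_N − B|`, DynCore at global equilibrium, S0). This is `Ccrux` — the `let`-bound functional of
`BoxDissipativeWeakStrong.EntropyAdmissibility` (`entropyAdmissibility_iff_inFrame : crux ↔ InFrame Ccrux` is `Iff.rfl`) — on
the sub-frame `InFrameConst` of constant profiles and constant Euler states; `inFrameConst_crux_of_crux` is the converse bookkeeping. -/
theorem inFrameConst_crux : InFrameConst Ccrux := by
  obtain ⟨η₀, hη₀, F, hFan, hFeq, -⟩ := BoxDissipativeWeakStrong.HsEosLowDensity_holds
  have hcont : ContinuousOn hsExcessFreeEnergy (Ico 0 η₀) :=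
    (hFan.continuousOn.mono fun η hη => ⟨(neg_lt_zero.2 hη₀).trans_le hη.1, hη.2⟩).congr hFeq
  refine InFrameConst.mono₂ (C₁ := Cdyn) (C₂ := Cstat) hη₀ one_half_pos ?_ inFrameConst_dyn
    (InFrameConst.of_inFrame inFrame_stat)
  intro σ η₁ ca cθ cu T cρ cϑ cv Φ ℓ τ a b φ hη₁ hs hca hcθ hσ ss _ _ _ hℓ _ _ hτ hab hφ _ c₁ c₂
  haveI hP : ∀ N, IsProbabilityMeasure (localGibbsLaw σ (fun _ => ca) (fun _ => cu) (fun _ => cθ) N (Φ N)) :=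
    fun N => isProbabilityMeasure_localGibbsLaw continuous_const continuous_const continuous_const (fun _ => hca)
      (fun _ => hcθ) ss.le N (Φ N)
  have hT : 0 < T := lt_of_le_of_lt hτ.1 hτ.2
  refine tendsto_lintegral_ofReal_of_le_add (fun N => localGibbsLaw σ (fun _ => ca) (fun _ => cu) (fun _ => cθ) N (Φ N))
    (fun N z => dynPart σ η₁ T ℓ Φ τ a b φ N z + initPart σ η₁ ℓ Φ a b φ N z)
    (fun N z => dynPart σ η₁ T ℓ Φ τ a b φ N z + initLimit σ η₁ (fun _ _ => cρ) (fun _ _ => cϑ) a b φ)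
    (fun N z => |initPart σ η₁ ℓ Φ a b φ N z - initLimit σ η₁ (fun _ _ => cρ) (fun _ _ => cϑ) a b φ|) (fun N z => ?_)
    (fun N => aemeasurable_ofReal_abs_initPart_sub hcont hσ.le hη₁.le hs Φ (hℓ N).1 hT hab.le hφ _ _) c₁ c₂
  have := le_abs_self (initPart σ η₁ ℓ Φ a b φ N z - initLimit σ η₁ (fun _ _ => cρ) (fun _ _ => cϑ) a b φ)
  linarith

/-- **Registered bookkeeping stub `stub_globalEquilibriumConclusions` (r10)** — the §3 sub-frame theorems, packaged: S1b, S2, DynCore and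
the crux's conclusion hold at global equilibrium; the sub-frame is the frame specialised. -/
theorem stub_globalEquilibriumConclusions : Sig.stub_globalEquilibriumConclusions :=
  ⟨inFrameConst_def, inFrameConst_conc, inFrameConst_dyn, inFrameConst_crux, inFrameConst_crux_of_crux,
    fun _ h => InFrameConst.of_inFrame h⟩

/-- **Macroscopic positive-time concentration (derived; open through S2a')** — for the record / the disprover's target list. -/
theorem macroConcentration : InFrame Cmacro :=
  stub_macroConcentration_of_PTBCInBand stub_positiveTimeBoxConcentrationInBand

/-! ### r13 — derived: the crux, S1b and S2 follow from the box-scale hydrodynamic limit in `L¹` (open through FS1–FS3 until they land) -/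

/-- **FS (derived): `InFrame Cptlgfs → InFrame CdynAbs`.** -/
theorem inFrame_dynAbs_of_fineScaleLLN (h : InFrame Cptlgfs) : InFrame CdynAbs :=
  stub_cruxOfFineScaleLLN stub_fsEntropyFunctionalsLLN
    (stub_clampedRenormalizedEntropyConservation stub_smoothRenormalizedEntropyConservation) h

/-- **The crux follows from the box-scale hydrodynamic limit in `L¹`** (`CdynAbs ⇒ Cdyn ⇒ crux`, landed sandwich). -/
theorem crux_of_fineScaleLLN (h : InFrame Cptlgfs) : BoxDissipativeWeakStrong.EntropyAdmissibility := by
  refine Summit.AtomisticToContinuum.HydrodynamicLimit.Theorems.EABirthCore.crux_of_inFrame_dyn ?_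
  refine Summit.AtomisticToContinuum.HydrodynamicLimit.Theorems.EABirthCore.InFrame.mono₂ (C₁ := CdynAbs)
    (C₂ := fun _ _ _ _ _ _ _ _ _ _ _ _ _ _ _ => True) one_pos one_pos ?_ (inFrame_dynAbs_of_fineScaleLLN h)
    Summit.AtomisticToContinuum.HydrodynamicLimit.Theorems.EABirthCore.InFrame.of_true
  intro σ η₁ a₀ θ₀ u₀ T ρ θ u Φ ℓ τ a b φ _ _ _ _ _ _ _ _ _ _ _ _ _ _ _ _ _ _ _ c₁ _
  exact tendsto_of_tendsto_of_tendsto_of_le_of_le' tendsto_const_nhds c₁ (Eventually.of_forall fun N => bot_le)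
    (Eventually.of_forall fun N => lintegral_mono fun z => ENNReal.ofReal_le_ofReal (le_abs_self _))

/-- **S1b follows from the box-scale hydrodynamic limit in `L¹`** (crux ⇒ S1b, landed necessity). -/
theorem meanEntropyDeficit_of_fineScaleLLN (h : InFrame Cptlgfs) : Sig.stub_meanEntropyDeficit :=
  meanEntropyDeficit_necessary (crux_of_fineScaleLLN h)

/-- **Registered bookkeeping stub `stub_fineScaleBridge` (r14)**: the crux `EntropyAdmissibility`, its heart S1b and `CdynAbs` follow from
the box-scale hydrodynamic limit in `L¹` — `GCH ⇐ S1b ⇐ crux ⇐ InFrame Cptlgfs` is the landed sandwich of the open content. -/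
theorem stub_fineScaleBridge : Sig.stub_fineScaleBridge :=
  ⟨inFrame_dynAbs_of_fineScaleLLN, crux_of_fineScaleLLN, fun h => meanEntropyDeficit_of_fineScaleLLN h⟩

/-! ## §4 Composition (sorry-free; unchanged from the birth skeleton) -/

/-- **Abstract squeeze** behind the composition: on probability spaces `(Ω_N, P_N)`, if `B_N → c` in `L¹`,
`A_N` is eventually integrable with `E[A_N] + c ≤ ε` eventually for every `ε > 0`, and `A_N − E[A_N] → 0` in `L¹`,
then `E[(A_N + B_N)⁺] → 0` (outer integrals `∫⁻ ofReal`, as in the crux). Pointwise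
`(A + B)⁺ ≤ |A − E A| + (E A + c)⁺ + |B − c|`; additivity of `∫⁻` uses the a.e.-measurability of the first two
summands (from integrability); the middle term is deterministic and `P_N(Ω_N) = 1`. -/
theorem tendsto_lintegral_ofReal_add_of_parts {Ω : ℕ → Type*} [∀ N, MeasurableSpace (Ω N)]
    (P : ∀ N, Measure (Ω N)) (hP : ∀ N, IsProbabilityMeasure (P N))
    (A B : ∀ N, Ω N → ℝ) (c : ℝ)
    (h0 : Tendsto (fun N => ∫⁻ z, ENNReal.ofReal |B N z - c| ∂P N) atTop (𝓝 0))
    (h1 : ∀ ε : ℝ, 0 < ε → ∀ᶠ N in atTop,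
      Integrable (A N) (P N) ∧ (∫ z, A N z ∂P N) + c ≤ ε)
    (h2 : Tendsto (fun N => ∫⁻ z, ENNReal.ofReal |A N z - ∫ z', A N z' ∂P N| ∂P N) atTop (𝓝 0)) :
    Tendsto (fun N => ∫⁻ z, ENNReal.ofReal (A N z + B N z) ∂P N) atTop (𝓝 0) := by
  -- the deterministic middle term tends to `0`
  have hreal : Tendsto (fun N => max ((∫ z, A N z ∂P N) + c) 0) atTop (𝓝 0) := by
    refine tendsto_order.2 ⟨fun a' ha' => Eventually.of_forall fun N => lt_of_lt_of_le ha' (le_max_right _ _),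
      fun a' ha' => ?_⟩
    filter_upwards [h1 (a' / 2) (half_pos ha')] with N hN
    exact max_lt (lt_of_le_of_lt hN.2 (half_lt_self ha')) ha'
  have hmid : Tendsto (fun N => ENNReal.ofReal (max ((∫ z, A N z ∂P N) + c) 0)) atTop (𝓝 0) := by
    have h := ENNReal.tendsto_ofReal hreal
    simpa only [ENNReal.ofReal_zero] using h
  have hsum : Tendsto (fun N => (∫⁻ z, ENNReal.ofReal |A N z - ∫ z', A N z' ∂P N| ∂P N) +
      ENNReal.ofReal (max ((∫ z, A N z ∂P N) + c) 0) +
      ∫⁻ z, ENNReal.ofReal |B N z - c| ∂P N) atTop (𝓝 0) := by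
    have h := (h2.add hmid).add h0
    simpa only [add_zero] using h
  refine tendsto_of_tendsto_of_tendsto_of_le_of_le' tendsto_const_nhds hsum
    (Eventually.of_forall fun N => bot_le) ?_
  filter_upwards [h1 1 one_pos] with N hN
  obtain ⟨hint, -⟩ := hN
  haveI : IsProbabilityMeasure (P N) := hP N
  set m : ℝ := ∫ z', A N z' ∂P N with hm
  -- pointwise splitting
  have hpt : ∀ z, ENNReal.ofReal (A N z + B N z) ≤
      ENNReal.ofReal |A N z - m| + ENNReal.ofReal (max (m + c) 0) + ENNReal.ofReal |B N z - c| := by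
    intro z
    have hle : A N z + B N z ≤ |A N z - m| + max (m + c) 0 + |B N z - c| := by
      have e1 := le_abs_self (A N z - m)
      have e2 := le_max_left (m + c) 0
      have e3 := le_abs_self (B N z - c)
      linarith
    calc ENNReal.ofReal (A N z + B N z)
        ≤ ENNReal.ofReal (|A N z - m| + max (m + c) 0 + |B N z - c|) := ENNReal.ofReal_le_ofReal hle
      _ ≤ ENNReal.ofReal (|A N z - m| + max (m + c) 0) + ENNReal.ofReal |B N z - c| :=
          ENNReal.ofReal_add_le
      _ ≤ ENNReal.ofReal |A N z - m| + ENNReal.ofReal (max (m + c) 0) + ENNReal.ofReal |B N z - c| :=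
          add_le_add ENNReal.ofReal_add_le le_rfl
  -- a.e.-measurability of the first summand (from integrability of `A N`)
  have hmeasA : AEMeasurable (fun z => ENNReal.ofReal |A N z - m|) (P N) :=
    (continuous_abs.measurable.comp_aemeasurable
      (hint.aestronglyMeasurable.aemeasurable.sub aemeasurable_const)).ennreal_ofReal
  have hmeasAC : AEMeasurable (fun z => ENNReal.ofReal |A N z - m| + ENNReal.ofReal (max (m + c) 0)) (P N) :=
    hmeasA.add aemeasurable_const
  calc ∫⁻ z, ENNReal.ofReal (A N z + B N z) ∂P N
      ≤ ∫⁻ z, (ENNReal.ofReal |A N z - m| + ENNReal.ofReal (max (m + c) 0) +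
          ENNReal.ofReal |B N z - c|) ∂P N := lintegral_mono fun z => hpt z
    _ = (∫⁻ z, (ENNReal.ofReal |A N z - m| + ENNReal.ofReal (max (m + c) 0)) ∂P N) +
          ∫⁻ z, ENNReal.ofReal |B N z - c| ∂P N := lintegral_add_left' hmeasAC _
    _ = (∫⁻ z, ENNReal.ofReal |A N z - m| ∂P N) + ENNReal.ofReal (max (m + c) 0) +
          ∫⁻ z, ENNReal.ofReal |B N z - c| ∂P N := by
        rw [lintegral_add_left' hmeasA, lintegral_const, measure_univ, mul_one]

/-- **The line closes the crux modulo its stubs**: `EntropyAdmissibility` BY NAME from S0, S1, S2. Real content: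
the common band threshold `min η₀ (min η₁ η₂)`, the common density threshold
`min (min σ₀ (min σ₁ σ₂)) (1/2)` (so that every local Gibbs law is a probability measure,
`isProbabilityMeasure_localGibbsLaw`), the identification of the crux's `let`-bound functional with
`dynPart + initPart`, and the squeeze `tendsto_lintegral_ofReal_add_of_parts`. -/
theorem EntropyAdmissibility_of (h₀ : Sig.stub_initialEntropyLLN) (h₁ : Sig.stub_meanEntropyInequality)
    (h₂ : Sig.stub_entropyBalanceConcentration) : BoxDissipativeWeakStrong.EntropyAdmissibility := by
  intro hEos
  obtain ⟨η0, hη0, H0⟩ := h₀ hEos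
  obtain ⟨η1, hη1, H1⟩ := h₁ hEos
  obtain ⟨η2, hη2, H2⟩ := h₂ hEos
  refine ⟨min η0 (min η1 η2), lt_min hη0 (lt_min hη1 hη2), ?_⟩
  intro η₁ hη₁ hη₁c a₀ θ₀ u₀ ha hθ hu ha0 hθ0
  have hη₁0 : η₁ < η0 := lt_of_lt_of_le hη₁c (min_le_left _ _)
  have hη₁1 : η₁ < η1 := lt_of_lt_of_le hη₁c ((min_le_right _ _).trans (min_le_left _ _))
  have hη₁2 : η₁ < η2 := lt_of_lt_of_le hη₁c ((min_le_right _ _).trans (min_le_right _ _))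
  obtain ⟨σ0, hσ0, G0⟩ := H0 η₁ hη₁ hη₁0 a₀ θ₀ u₀ ha hθ hu ha0 hθ0
  obtain ⟨σ1, hσ1, G1⟩ := H1 η₁ hη₁ hη₁1 a₀ θ₀ u₀ ha hθ hu ha0 hθ0
  obtain ⟨σ2, hσ2, G2⟩ := H2 η₁ hη₁ hη₁2 a₀ θ₀ u₀ ha hθ hu ha0 hθ0
  refine ⟨min (min σ0 (min σ1 σ2)) (1 / 2), lt_min (lt_min hσ0 (lt_min hσ1 hσ2)) one_half_pos, ?_⟩
  intro σ hσ hσlt T ρ θ u hsol hguard Φ hLLN ℓ hℓ hℓ0 hℓ3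
  have hσm : σ < min σ0 (min σ1 σ2) := lt_of_lt_of_le hσlt (min_le_left _ _)
  have hσ0' : σ < σ0 := lt_of_lt_of_le hσm (min_le_left _ _)
  have hσ1' : σ < σ1 := lt_of_lt_of_le hσm ((min_le_right _ _).trans (min_le_left _ _))
  have hσ2' : σ < σ2 := lt_of_lt_of_le hσm ((min_le_right _ _).trans (min_le_right _ _))
  have hσhalf : σ ≤ 1 / 2 := le_of_lt (lt_of_lt_of_le hσlt (min_le_right _ _))
  have F0 := G0 σ hσ hσ0' T ρ θ u hsol hguard Φ hLLN ℓ hℓ hℓ0 hℓ3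
  have F1 := G1 σ hσ hσ1' T ρ θ u hsol hguard Φ hLLN ℓ hℓ hℓ0 hℓ3
  have F2 := G2 σ hσ hσ2' T ρ θ u hsol hguard Φ hLLN ℓ hℓ hℓ0 hℓ3
  intro K Dn Mm En Th Fc Sc τ hτ a b hab φ hφ hφ0
  have E0 := F0 τ hτ a b hab φ hφ hφ0
  have E1 := F1 τ hτ a b hab φ hφ hφ0
  have E2 := F2 τ hτ a b hab φ hφ hφ0
  have hP : ∀ N, IsProbabilityMeasure (localGibbsLaw σ a₀ u₀ θ₀ N (Φ N)) := fun N =>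
    isProbabilityMeasure_localGibbsLaw ha hθ hu ha0 hθ0 hσhalf N (Φ N)
  exact tendsto_lintegral_ofReal_add_of_parts (fun N => localGibbsLaw σ a₀ u₀ θ₀ N (Φ N)) hP
    (fun N z => dynPart σ η₁ T ℓ Φ τ a b φ N z) (fun N z => initPart σ η₁ ℓ Φ a b φ N z)
    (initLimit σ η₁ ρ θ a b φ) E0 E1 E2

/-- The skeleton instantiated: the crux modulo the registered stubs (through the derived S0, S1, S2; open: S1b, S2a'). -/
theorem EntropyAdmissibility_skeleton : BoxDissipativeWeakStrong.EntropyAdmissibility :=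
  EntropyAdmissibility_of initialEntropyLLN meanEntropyInequality entropyBalanceConcentration

end Summit.AtomisticToContinuum.HydrodynamicLimit.Cruxes.EntropyAdmissibility.Birth

end
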